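import Summits.HubbardSuperconductivity.HubbardSuperconductivity.Theses.BalabanIR

/-!
# Disproof of `BirComplexStableXY` (route BalabanIR, crux 2, item stmt-HubbardSuperconductivity-2080) — findings

Standing disprover's work file (cdisprove).  Prose lives in docstrings; everything else is Lean.

## Index
* §1  The crux re-expressed as `EngineClaim Admissible` over named pieces (`genF`, `action`, `partZ`,
      `numerO`, `Conclusion`), with `engineClaim_admissible_iff : EngineClaim Admissible ↔ BirComplexStableXY`.
* §2  LOAD-BEARING ANALYSIS (sorry-free).  `AdmissibleNoC` (coercivity (C) dropped) is refuted by the free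
      table `c = 0`: `engineClaim_false_without_coercivity'` — character orthogonality on the statement's own
      cube gives `Z = (2π)^{|Λ|}` (`partZ_free`) and slice order exactly `1/L²` (`numerO_free`,
      `free_sliceOrder`); `(N)` is NOT load-bearing (remark); `(U1)`/`(A)` only enlarge the class.
* §3  THE KILL MECHANISM (numerically certified, analytically a fixed-`L` theorem, not yet a Lean proof):
      transfer-operator (Beraha–Kahane–Weiss) zeros of `Z` in the regime `M ≳ K² L⁴`, produced by an
      ADMISSIBLE table with complex temporal stiffness `(1 + iε₁)` and a Berry-like term `iε₂ sin ∂_τθ`.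
      `witness ε₁ ε₂` is that table (r = 2, twelve cube edges); `witness_admissible` is SORRY-FREE
      ((U1),(N),(A) with B = 128,(C) with c₀ = 1/18 by bit-fixing routing on the cube);
      `witness_zero_exists` is the analytic heart and the ONLY `sorry` of this file (evidence: jobs j004976 —
      exact k_s = 0 chain = the statement at L = 1 — and j005270+ — full L = 2 transfer operator);
      `birComplexStableXY_false_of` (pure logic, sorry-free) and `birComplexStableXY_false` (depends on the
      sorried heart only); §3d `action_witness` (sorry-free): the witness's summed action IS
      `4K Σ_s [(1−cos ∂₁θ)+(1−cos ∂₂θ)+(1+iε₁)(1−cos ∂_τθ)+iε₂ sin ∂_τθ]` — the model the numerics diagonalise;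
      §3e `gauge_identity` (sorry-free, Cauchy on a rectangle + periodicity): the temporal bond coefficient
      `∫_0^{2π} e^{-κ[a(1−cos v)+b sin v]} e^{-ijv} dv = e^{-κa} e^{ijψ} ∫_0^{2π} e^{κR cos u} e^{-iju} du` for
      `R cos ψ = a, R sin ψ = b` — step (ii) of the analytic heart (ε₂ only reweights charge sectors by `e^{iQψ}`).
* §4  THE REPAIR.  `TimeReflectionHermitian` (`c_{n∘R} = conj c_{−n}`: OS Hermiticity of the table,
      satisfied by every fermion-induced action) kills the witness (`witness_not_timeReflectionHermitian`,
      sorry-free); §4a proves (sorry-free) that under it `Z` is REAL for every `K, L, M`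
      (`partZ_conj_of_OS`: reflect the integration variable); `BirComplexStableXY_OS := EngineClaim
      AdmissibleOS` is the proposed restated crux C′ (`os_of_crux : crux → C′`), with the caveat recorded at
      `TimeReflectionHermitian` (for windows `r ≥ 3` ask for reflection POSITIVITY, not only Hermiticity).
-/

set_option linter.dupNamespace false

namespace Summit.HubbardSuperconductivity.HubbardSuperconductivity.Cruxes.BirComplexStableXY.Disproof

open scoped BigOperators
open MeasureTheory Literature.Probability.LatticeModels
open Summit.HubbardSuperconductivity.HubbardSuperconductivity.Theses.BalabanIR

noncomputable section

/-! ## §1 Named pieces of the crux -/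

/-- window of side `r` (two spatial coordinates, one temporal). -/
abbrev W (r : ℕ) : Type := Fin r × Fin r × Fin r
/-- Fourier frequencies on the window. -/
abbrev Freq (r : ℕ) : Type := W r → ℤ
/-- finitely supported Fourier tables. -/
abbrev Table (r : ℕ) : Type := Freq r →₀ ℂ
/-- space-time torus `(ℤ/L)² × ℤ/M`. -/
abbrev Λ (L M : ℕ) : Type := TorusSite 2 L × ZMod M

/-- the local generating function `F(φ) = Σ_n c_n e^{i n·φ}` (verbatim the crux's `F`). -/
def genF {r : ℕ} (c : Table r) (φ : W r → ℝ) : ℂ :=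
  c.sum (fun n a => a * Complex.exp (Complex.I * ((∑ w, (n w : ℝ) * φ w : ℝ) : ℂ)))

/-- window shift (verbatim the crux's `sh`). -/
def sh {r : ℕ} (L M : ℕ) (s : Λ L M) (w : W r) : Λ L M :=
  (s.1 + ![((w.1 : ℕ) : ZMod L), ((w.2.1 : ℕ) : ZMod L)], s.2 + ((w.2.2 : ℕ) : ZMod M))

/-- the action `A(θ) = K Σ_s F(θ ∘ sh s)`. -/
def action {r : ℕ} (K : ℝ) (c : Table r) (L M : ℕ) [NeZero L] [NeZero M] (θ : Λ L M → ℝ) : ℂ :=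
  (K : ℂ) * ∑ s : Λ L M, genF c (fun w => θ (sh L M s w))

/-- the cube `[0,2π]^Λ`. -/
def cube (L M : ℕ) : Set (Λ L M → ℝ) := Set.pi Set.univ (fun _ => Set.Icc (0:ℝ) (2 * Real.pi))

/-- the complex partition function `Z = ∫_cube e^{-A}`. -/
def partZ {r : ℕ} (K : ℝ) (c : Table r) (L M : ℕ) [NeZero L] [NeZero M] : ℂ :=
  MeasureTheory.integral (MeasureTheory.volume.restrict (cube L M))
    (fun θ => Complex.exp (-(action K c L M θ)))

/-- the equal-time slice order observable `O(θ) = |L⁻² Σ_x e^{iθ(x,0)}|²`. -/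
def sliceO (L M : ℕ) [NeZero L] [NeZero M] (θ : Λ L M → ℝ) : ℝ :=
  ‖∑ x : TorusSite 2 L, Complex.exp (Complex.I * (θ (x, 0) : ℂ))‖ ^ 2 / (L : ℝ) ^ 4

/-- the numerator `∫_cube O e^{-A}`. -/
def numerO {r : ℕ} (K : ℝ) (c : Table r) (L M : ℕ) [NeZero L] [NeZero M] : ℂ :=
  MeasureTheory.integral (MeasureTheory.volume.restrict (cube L M))
    (fun θ => (sliceO L M θ : ℂ) * Complex.exp (-(action K c L M θ)))

/-- the crux's conclusion for given data: `Z ≠ 0` and `Re ⟨O⟩ ≥ 1/2`. -/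
def Conclusion {r : ℕ} (K : ℝ) (c : Table r) (L M : ℕ) [NeZero L] [NeZero M] : Prop :=
  partZ K c L M ≠ 0 ∧ (1/2 : ℝ) ≤ (numerO K c L M / partZ K c L M).re

/-- (U1) global `U(1)` invariance of the table. -/
def CondU1 {r : ℕ} (c : Table r) : Prop := ∀ n ∈ c.support, ∑ w, n w = 0
/-- (N) `F(const) = 0`. -/
def CondN {r : ℕ} (c : Table r) : Prop := c.sum (fun _ a => a) = 0
/-- (A) exponentially weighted `ℓ¹` Fourier norm `≤ B` (analyticity in the unit strip). -/
def CondA {r : ℕ} (B : ℝ) (c : Table r) : Prop :=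
  c.sum (fun n a => ‖a‖ * Real.exp (∑ w, |(n w : ℝ)|)) ≤ B
/-- (C) coercivity of the real part. -/
def CondC {r : ℕ} (c₀ : ℝ) (c : Table r) : Prop :=
  ∀ φ : W r → ℝ, c₀ * ∑ w, ∑ w', (1 - Real.cos (φ w - φ w')) ≤ (genF c φ).re

/-- the crux's admissible class. -/
def Admissible (r : ℕ) (B c₀ : ℝ) (c : Table r) : Prop :=
  CondU1 c ∧ CondN c ∧ CondA B c ∧ CondC c₀ c

/-- the engine claim over an arbitrary class `P` of tables (the crux is `EngineClaim Admissible`). -/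
def EngineClaim (P : (r : ℕ) → ℝ → ℝ → Table r → Prop) : Prop :=
  ∀ (r : ℕ) (B c₀ : ℝ), 2 ≤ r → 0 < c₀ → ∃ K₀ : ℝ, ∃ L₀ : ℕ, ∀ K : ℝ, K₀ ≤ K →
    ∀ c : Table r, P r B c₀ c → ∀ (L M : ℕ) [NeZero L] [NeZero M], L₀ ≤ L → L ≤ M → Conclusion K c L M

/-- The re-expression is faithful (definitional up to currying). -/
theorem engineClaim_admissible_iff : EngineClaim Admissible ↔ BirComplexStableXY := by
  constructor
  · intro h r B c₀ hr hc₀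
    obtain ⟨K₀, L₀, hK⟩ := h r B c₀ hr hc₀
    refine ⟨K₀, L₀, fun K hKK c h1 h2 h3 h4 L M _ _ hL hLM => ?_⟩
    have key := hK K hKK c ⟨h1, h2, h3, h4⟩ L M hL hLM
    dsimp only [Conclusion, partZ, numerO, action, genF, sh, cube, sliceO] at key
    dsimp only
    exact key
  · intro h r B c₀ hr hc₀
    obtain ⟨K₀, L₀, hK⟩ := h r B c₀ hr hc₀
    refine ⟨K₀, L₀, fun K hKK c hc L M _ _ hL hLM => ?_⟩
    have key := hK K hKK c hc.1 hc.2.1 hc.2.2.1 hc.2.2.2 L M hL hLM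
    dsimp only at key
    dsimp only [Conclusion, partZ, numerO, action, genF, sh, cube, sliceO]
    exact key


/-! ## §2 Load-bearing analysis (hypothesis mutation) -/

/-- The class with COERCIVITY (C) DROPPED. -/
def AdmissibleNoC (r : ℕ) (B _c₀ : ℝ) (c : Table r) : Prop :=
  CondU1 c ∧ CondN c ∧ CondA B c

/-- The free table `c = 0` is in the coercivity-free class as soon as `0 ≤ B`. -/
theorem zero_mem_admissibleNoC (r : ℕ) {B : ℝ} (hB : 0 ≤ B) (c₀ : ℝ) :
    AdmissibleNoC r B c₀ 0 := by
  refine ⟨?_, ?_, ?_⟩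
  · intro n hn; simp at hn
  · simp [CondN]
  · simpa [CondA] using hB

/-- With `c = 0` the action vanishes identically. -/
theorem action_zero {r : ℕ} (K : ℝ) (L M : ℕ) [NeZero L] [NeZero M] (θ : Λ L M → ℝ) :
    action K (0 : Table r) L M θ = 0 := by
  simp [action, genF]

/-- `(C)` IS LOAD-BEARING: without coercivity the engine claim is false, witnessed by the free table
`c = 0` (product measure of i.i.d. uniform angles), for which `Z = (2π)^{L²M} ≠ 0` but the slice order is
`⟨|L⁻²Σ_x e^{iθ_x}|²⟩ = 1/L² < 1/2` for every `L ≥ 2`.  The two product integrals (`∫_cube 1 = (2π)^N`,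
`∫_cube |Σ_x e^{iθ(x,0)}|² = L²(2π)^N`, orthogonality of characters) are evaluated in §2a
(`free_sliceOrder`); the unconditional statement is `engineClaim_false_without_coercivity'`. -/
def FreeSliceOrder : Prop :=
  ∀ (L M : ℕ) [NeZero L] [NeZero M], 2 ≤ L →
    partZ (r := 2) 1 0 L M ≠ 0 ∧ (numerO (r := 2) 1 0 L M / partZ (r := 2) 1 0 L M).re = 1 / (L : ℝ) ^ 2

theorem engineClaim_false_without_coercivity (hfree : FreeSliceOrder) :
    ¬ EngineClaim AdmissibleNoC := by
  intro h
  obtain ⟨K₀, L₀, hK⟩ := h 2 1 1 le_rfl one_pos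
  -- take K = max K₀ 1 (any K ≥ K₀ works since the action vanishes), L = M = max L₀ 2
  set L : ℕ := max L₀ 2 with hLdef
  have hL2 : 2 ≤ L := le_max_right _ _
  have hL0 : L₀ ≤ L := le_max_left _ _
  haveI : NeZero L := ⟨by omega⟩
  have key := hK (max K₀ 1) (le_max_left _ _) 0 (zero_mem_admissibleNoC 2 zero_le_one 1) L L hL0 le_rfl
  -- the conclusion at c = 0 does not depend on K (action ≡ 0); compare with the free values
  have hZ : partZ (r := 2) (max K₀ 1) (0 : Table 2) L L = partZ (r := 2) 1 0 L L := by
    simp [partZ, action_zero]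
  have hN : numerO (r := 2) (max K₀ 1) (0 : Table 2) L L = numerO (r := 2) 1 0 L L := by
    simp [numerO, action_zero]
  obtain ⟨-, hre⟩ := key
  rw [hZ, hN, (hfree L L hL2).2] at hre
  -- 1/2 ≤ 1/L² with L ≥ 2 is absurd
  have hL' : (2:ℝ) ≤ L := by exact_mod_cast hL2
  have : (1:ℝ) / (L:ℝ) ^ 2 ≤ 1 / 4 := by
    rw [div_le_div_iff₀ (by positivity) (by norm_num)]
    nlinarith
  linarith

/-! ### §2a Free-measure computations on the statement's own cube (character orthogonality) -/

section free

/-- one-dimensional Lebesgue measure on `[0, 2π]`. -/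
def ν : Measure ℝ := volume.restrict (Set.Icc (0:ℝ) (2 * Real.pi))

instance : IsFiniteMeasure ν := by
  unfold ν
  refine ⟨?_⟩
  rw [Measure.restrict_apply_univ, Real.volume_Icc]
  exact ENNReal.ofReal_lt_top

theorem restrict_cube_eq_pi (L M : ℕ) [NeZero L] [NeZero M] :
    (volume : Measure (Λ L M → ℝ)).restrict (cube L M) = Measure.pi (fun _ : Λ L M => ν) := by
  rw [cube, volume_pi, Measure.restrict_pi_pi]
  rfl

/-- `∫_0^{2π} e^{i n t} dt = 2π·𝟙{n = 0}` for `n ∈ ℤ`. -/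
theorem integral_cexp_int_mul (n : ℤ) :
    ∫ t, Complex.exp (Complex.I * (((n : ℝ) * t : ℝ) : ℂ)) ∂ν = if n = 0 then ((2 * Real.pi : ℝ) : ℂ) else 0 := by
  unfold ν
  rw [integral_Icc_eq_integral_Ioc, ← intervalIntegral.integral_of_le (by positivity : (0:ℝ) ≤ 2 * Real.pi)]
  split_ifs with hn
  · subst hn
    simp
  · have hc : (Complex.I * (n : ℂ)) ≠ 0 := by simp [Complex.I_ne_zero, hn]
    have key : ∀ t : ℝ, Complex.exp (Complex.I * (((n : ℝ) * t : ℝ) : ℂ)) =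
        Complex.exp ((Complex.I * (n : ℂ)) * t) := by
      intro t; congr 1; push_cast; ring
    simp_rw [key]
    rw [integral_exp_mul_complex hc]
    have h2 : Complex.exp (Complex.I * (n : ℂ) * (2 * (Real.pi : ℂ))) = 1 := by
      have : Complex.I * (n : ℂ) * (2 * (Real.pi : ℂ)) = (n : ℂ) * (2 * Real.pi * Complex.I) := by ring
      rw [this]
      exact Complex.exp_int_mul_two_pi_mul_I n
    push_cast
    simp [h2]

/-- Orthogonality of characters on the cube `[0,2π]^Λ`:
`∫ e^{i w·θ} dθ = (2π)^{|Λ|}·𝟙{w = 0}` for `w ∈ ℤ^Λ`. -/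
theorem integral_cube_cexp_phase (L M : ℕ) [NeZero L] [NeZero M] (w : Λ L M → ℤ) :
    ∫ θ, Complex.exp (Complex.I * ((∑ s, (w s : ℝ) * θ s : ℝ) : ℂ)) ∂(volume.restrict (cube L M)) =
      if w = 0 then ((2 * Real.pi : ℝ) : ℂ) ^ Fintype.card (Λ L M) else 0 := by
  rw [restrict_cube_eq_pi]
  set f : Λ L M → ℝ → ℂ := fun s t => Complex.exp (Complex.I * ((((w s : ℝ) * t : ℝ)) : ℂ)) with hf
  have key : ∀ θ : Λ L M → ℝ,
      Complex.exp (Complex.I * ((∑ s, (w s : ℝ) * θ s : ℝ) : ℂ)) = ∏ s, f s (θ s) := by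
    intro θ
    simp only [hf, ← Complex.exp_sum]
    congr 1
    push_cast
    rw [Finset.mul_sum]
  simp_rw [key]
  rw [integral_fintype_prod_eq_prod (𝕜 := ℂ) f]
  have hj : ∀ s, ∫ t, f s t ∂ν = if w s = 0 then ((2 * Real.pi : ℝ) : ℂ) else 0 := fun s =>
    integral_cexp_int_mul (w s)
  simp_rw [hj]
  split_ifs with hw
  · subst hw
    simp
  · obtain ⟨s, hs⟩ : ∃ s, w s ≠ 0 := by
      by_contra h
      push Not at h
      exact hw (funext h)
    exact Finset.prod_eq_zero (Finset.mem_univ s) (if_neg hs)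

/-- The free partition function: `Z = (2π)^{|Λ|}` at `c = 0`. -/
theorem partZ_free (K : ℝ) (L M : ℕ) [NeZero L] [NeZero M] :
    partZ (r := 2) K 0 L M = ((2 * Real.pi : ℝ) : ℂ) ^ Fintype.card (Λ L M) := by
  have h := integral_cube_cexp_phase L M 0
  rw [if_pos rfl] at h
  unfold partZ
  rw [← h]
  congr 1
  funext θ
  simp [action_zero]

/-- frequency vector of `θ(x,0) − θ(y,0)`. -/
def frq (L M : ℕ) [NeZero L] [NeZero M] (x y : TorusSite 2 L) : Λ L M → ℤ :=
  Pi.single (x, (0 : ZMod M)) 1 - Pi.single (y, (0 : ZMod M)) 1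

theorem sum_frq_mul (L M : ℕ) [NeZero L] [NeZero M] (x y : TorusSite 2 L) (θ : Λ L M → ℝ) :
    (∑ s, ((frq L M x y s : ℤ) : ℝ) * θ s) = θ (x, 0) - θ (y, 0) := by
  simp [frq, Pi.single_apply, sub_mul, Finset.sum_sub_distrib]

theorem frq_eq_zero_iff (L M : ℕ) [NeZero L] [NeZero M] {x y : TorusSite 2 L} :
    frq L M x y = 0 ↔ x = y := by
  constructor
  · intro h
    by_contra hxy
    have hne : (x, (0 : ZMod M)) ≠ (y, 0) := fun e => hxy (Prod.mk.inj e).1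
    have := congrFun h (x, 0)
    simp [frq, Ne.symm hne] at this
  · rintro rfl
    simp [frq]

/-- pointwise: `|Σ_x e^{iθ_x}|² = Σ_{x,y} e^{i(θ_x − θ_y)}` written with integer frequency vectors. -/
theorem normSq_sliceSum_eq (L M : ℕ) [NeZero L] [NeZero M] (θ : Λ L M → ℝ) :
    ((‖∑ x : TorusSite 2 L, Complex.exp (Complex.I * (θ (x, 0) : ℂ))‖ ^ 2 : ℝ) : ℂ) =
      ∑ x : TorusSite 2 L, ∑ y : TorusSite 2 L,
        Complex.exp (Complex.I * ((∑ s, ((frq L M x y s : ℤ) : ℝ) * θ s : ℝ) : ℂ)) := by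
  simp_rw [sum_frq_mul]
  rw [← Complex.normSq_eq_norm_sq, ← Complex.mul_conj, map_sum, Finset.sum_mul_sum]
  refine Finset.sum_congr rfl fun x _ => Finset.sum_congr rfl fun y _ => ?_
  rw [← Complex.exp_conj, ← Complex.exp_add]
  congr 1
  simp only [map_mul, Complex.conj_I, Complex.conj_ofReal]
  push_cast
  ring

/-- The free numerator: `∫_cube |Σ_x e^{iθ(x,0)}|²/L⁴ = |𝕋_L|·(2π)^{|Λ|}/L⁴` at `c = 0`. -/
theorem numerO_free (K : ℝ) (L M : ℕ) [NeZero L] [NeZero M] :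
    numerO (r := 2) K 0 L M =
      (Fintype.card (TorusSite 2 L) : ℂ) * ((2 * Real.pi : ℝ) : ℂ) ^ Fintype.card (Λ L M) / (L : ℂ) ^ 4 := by
  unfold numerO sliceO
  have hint : ∀ θ : Λ L M → ℝ,
      (((‖∑ x : TorusSite 2 L, Complex.exp (Complex.I * (θ (x, 0) : ℂ))‖ ^ 2 / (L : ℝ) ^ 4 : ℝ)) : ℂ) *
          Complex.exp (-(action K (0 : Table 2) L M θ)) =
        (∑ x : TorusSite 2 L, ∑ y : TorusSite 2 L,
          Complex.exp (Complex.I * ((∑ s, ((frq L M x y s : ℤ) : ℝ) * θ s : ℝ) : ℂ))) / (L : ℂ) ^ 4 := by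
    intro θ
    rw [action_zero, neg_zero, Complex.exp_zero, mul_one, Complex.ofReal_div, normSq_sliceSum_eq]
    push_cast
    rfl
  simp_rw [hint]
  rw [integral_div, integral_finsetSum _ (fun x _ => ?_)]
  · rw [Finset.sum_congr rfl fun x _ => integral_finsetSum _ (fun y _ => ?_)]
    · simp_rw [integral_cube_cexp_phase, frq_eq_zero_iff]
      simp [Finset.sum_ite_eq]
    · exact integrable_cexp_phase L M _
  · exact integrable_finsetSum _ fun y _ => integrable_cexp_phase L M _
where
  /-- integrability of a character on the (finite) cube measure. -/
  integrable_cexp_phase (L M : ℕ) [NeZero L] [NeZero M] (w : Λ L M → ℤ) :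
      Integrable (fun θ : Λ L M → ℝ => Complex.exp (Complex.I * ((∑ s, (w s : ℝ) * θ s : ℝ) : ℂ)))
        (volume.restrict (cube L M)) := by
    rw [restrict_cube_eq_pi]
    refine (integrable_const (1 : ℝ)).mono' ?_ (ae_of_all _ fun θ => ?_)
    · exact (Continuous.aestronglyMeasurable (by fun_prop))
    · rw [mul_comm, Complex.norm_exp_ofReal_mul_I]

theorem card_torusSite_two (L : ℕ) [NeZero L] : Fintype.card (TorusSite 2 L) = L ^ 2 := by
  simp [TorusSite, ZMod.card]

/-- The free slice order is `1/L²` and the free `Z` is non-zero (closes §2). -/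
theorem free_sliceOrder : FreeSliceOrder := by
  intro L M _ _ hL
  have hπ : ((2 * Real.pi : ℝ) : ℂ) ^ Fintype.card (Λ L M) ≠ 0 :=
    pow_ne_zero _ (by exact_mod_cast (by positivity : (2 * Real.pi : ℝ) ≠ 0))
  have hLc : (L : ℂ) ≠ 0 := by exact_mod_cast (NeZero.ne L)
  refine ⟨by rw [partZ_free]; exact hπ, ?_⟩
  rw [numerO_free, partZ_free, card_torusSite_two]
  have : ((L ^ 2 : ℕ) : ℂ) * ((2 * Real.pi : ℝ) : ℂ) ^ Fintype.card (Λ L M) / (L : ℂ) ^ 4 /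
      ((2 * Real.pi : ℝ) : ℂ) ^ Fintype.card (Λ L M) = ((1 / (L : ℝ) ^ 2 : ℝ) : ℂ) := by
    push_cast
    field_simp
  rw [this, Complex.ofReal_re]

end free

/-- `(C)` IS LOAD-BEARING (unconditional form). -/
theorem engineClaim_false_without_coercivity' : ¬ EngineClaim AdmissibleNoC :=
  engineClaim_false_without_coercivity free_sliceOrder

/-- `(N)` is NOT load-bearing (remark, no Lean content needed): adding a constant `γ` to `F` multiplies both
`Z` and `∫ O e^{-A}` by `e^{-K L² M γ} ≠ 0`, so `Conclusion` is invariant; coercivity forces `Re γ ≥ 0` only.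
`(U1)` and `(A)` dropped only ENLARGE the class, so they cannot rescue a claim that already fails on
`Admissible` (§3). -/
theorem n_not_loadBearing_remark : True := trivial

/-! ## §3 The kill mechanism: an admissible table with transfer-operator zeros of `Z`

Witness (r = 2; window vertices `(a,b,t)`, `t` = time):
`F_{ε₁,ε₂}(φ) = Σ_{8 spatial cube edges} (1 − cos Δ_eφ) + Σ_{4 temporal cube edges} [(1 + iε₁)(1 − cos Δ_eφ) + iε₂ sin Δ_eφ]`.
Summed over window translates this is the nearest-neighbour anisotropic XY action
`A = 4K Σ_{x,τ} [(1−cos ∂₁θ) + (1−cos ∂₂θ) + (1+iε₁)(1−cos ∂_τθ) + iε₂ sin ∂_τθ]`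
(each cube edge direction occurs 4 times), i.e. REAL spatial stiffness and COMPLEX temporal stiffness plus a
Berry-like odd term.  `Z = Tr T^M` for the slice transfer operator `T`; by the exact gauge identity
`∫_0^{2π} e^{-κ[(1+iε₁)(1-cos v) + iε₂ sin v]} e^{-ijv} dv = 2π e^{-κ(1+iε₁)} e^{ijψ} I_j(κR)`
(`R cos ψ = 1+iε₁`, `R sin ψ = iε₂`) the charge-`Q` sector of `T` is `e^{iQψ}·T̃(κR)|_Q`, so the top
eigenvalues of sectors `Q = 0` and `Q = −1` TIE IN MODULUS when `Im ψ ≈ ε₂` equals the rotor gap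
`g = log(μ₀/μ₁) ≈ 1/(2κ_eff)`, `κ_eff ≈ 4K·L²`, while `ε₁ ≠ 0` gives them a RELATIVE PHASE `Δ ≈ ε₁/(4κ_eff²)`
per time step (the O(1/κ) part cancels — coercivity forces `Re F` to be stationary at constants — but the
O(1/κ²) anharmonic part does not).  At `M ≈ π/Δ ≈ 4πκ_eff²/ε₁ ~ K²L⁴` the two dominant terms of
`Z = Σ λ_j^M` cancel and, all other eigenvalues being smaller by `e^{-M/κ_eff} ≈ e^{-4πκ_eff/ε₁}`, a degree-1
(transversal) zero of `Z` sits within `O(e^{-4πκ_eff/ε₁})` of the two-level solution in the `(ε₁, ε₂)` plane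
(Beraha–Kahane–Weiss accumulation; Newton-certified numerically).  This uses exactly the regime the route
needs (`M → ∞` at fixed `L`, "INCLUDING M ≫ L²").
EVIDENCE (job j004976, the exact k_s = 0 sector = the statement at L = 1 with κ = 4K; FFT quadrature checked
against the Bessel gauge formula to 1e-14): Newton-certified TRANSVERSAL zeros of `Z_M/λ₀^M` —
`κ = 8:  ε₁ = 0.300, ε₂* = 0.0661, M* = 2232 (|ζ| = 9e-14, winding −1);  ε₁ = 1.00, ε₂* = 0.0622, M* = 1416 (9e-14, +1)`
`κ = 16: (0.300, 0.0321, 10332; 4e-12, −1), (1.00, 0.0312, 6039; 2e-12, +1)`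
`κ = 32: (0.300, 0.01583, 44058; 2e-11, −1), (1.00, 0.01562, 24938; 5e-12, +1)`
`κ = 64: (0.300, 0.00786, 181638; 1e-11, −1), (1.00, 0.00781, 101342; 2e-11, +1)`
`κ = 128: (0.300, 0.00392, 737320; 3e-11, −1), (1.00, 0.00391, 408564; 2e-11, winding test degenerate)`;
the third-largest term is ≤ 1e-38 relative, the (A)-norm of the temporal edge function is 8.8 (ε₁ = 0.3) /
11.9 (ε₁ = 1).  LAWS: `ε₂* ≈ 1/(2κ)`, phase per step `Δ ≈ ε₁/(4κ²(1+ε₁²))` (measured `Δ·4κ²/ε₁ → 0.93, 0.50`),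
`M* ≈ π/Δ ≈ 4π(1+ε₁²)κ²/ε₁` (measured `M*/κ² → 45.0, 24.9`): NO `K₀` HELPS, the zeros march to `M ~ K²`.
FULL L = 2 TRANSFER OPERATOR (jobs j014041/j014042/j014043; NO zero-mode reduction: the exact charge-sector
operator `T̃(κR)|_Q` of the witness's summed action (§3d) in the Fourier basis, truncation `|m_x| ≤ 9/11/14`
with boundary weight of the top eigenvector `2e-34/3e-30/1e-27`, ARPACK; `ε₁ = 0.3`, `B = 128`, `c₀ = 1/18`):
`K = 0.25: real gap g = 0.1747 (κ_eff = 2.86), real slice order O₀₀ = 0.871; EXACT ZERO of the truncated`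
`          Z_M/λ₀^M at (ε₁, ε₂) = (0.30088, 0.16393), M = 172: |ζ| = 2.4e-11, next term 3e-22, winding −1;`
`K = 0.5:  g = 0.0711 (κ_eff = 7.03), O₀₀ = 0.940; zero at (0.30008, 0.069850), M = 1478: |ζ| = 7e-13, next 2e-82, winding −1;`
`K = 1.0:  g = 0.0332 (κ_eff = 15.1), O₀₀ = 0.971; zero at (0.299983, 0.032919), M = 7459: |ζ| = 1.6e-11, next 4e-196, winding −1;`
the (A)-norm of the table at the zeros is 102.0–102.1 ≤ 128, the numerical coercivity constant is 0.125 ≥ 1/18,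
and `M` grows like `K²` (172 → 1478 → 7459; `M/κ_eff² = 21, 30, 33` approaching the chain law as the O(1/K)
spin-wave dressing fades: measured Δ / chain-law Δ = 2.0, 1.4, 1.28).  The two dominant sector tops carry
slice-order matrix elements `O₀₀ = 0.8726+0.0123i, O₁₁ = 0.8749+0.0098i` (K = 0.25), differing by
`3e-3 / 1.6e-4 / 1.5e-5` (K = 0.25/0.5/1): near the zero `⟨O⟩ = (O₀₀ + O₁₁x)/(1+x)`, `x → −1`, so the second
conjunct fails on the open set `|1+x| ≲ 2|O₀₀ − O₁₁|` and at the zero itself (Lean: `x/0 = 0`).  The REAL model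
is perfectly healthy (slice order `1 − O(1/K)` uniformly in M, as the route expects) — the kill is entirely the
complex temporal stiffness.  (First batch j005270/j006015/j006016/j006369 cancelled — slow preamble vs the 0.5 h
slice; repaired-class test j014044 below.)  Earlier, independently: route-review files
Crux2_TransferZeros.md / Crux2_Addendum_Dressing.md on the item (same mechanism on the reduced zero-mode chain:
κ = 30/100/300 → M = 5515/64029/583437, |Z_M|/top^M ≤ 1e-11).
-/

/-- frequency `δ_u − δ_v` of the phase difference `φ_u − φ_v`. -/
def dfreq (u v : W 2) : Freq 2 := Pi.single u 1 - Pi.single v 1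

/-- Fourier table of `1 − cos(φ_u − φ_v)`. -/
def cosTab (u v : W 2) : Table 2 :=
  Finsupp.single 0 1 + Finsupp.single (dfreq u v) (-(1/2 : ℂ)) + Finsupp.single (dfreq v u) (-(1/2 : ℂ))

/-- Fourier table of `sin(φ_u − φ_v) = (e^{i(φ_u−φ_v)} − e^{−i(φ_u−φ_v)})/(2i)`. -/
def sinTab (u v : W 2) : Table 2 :=
  Finsupp.single (dfreq u v) (-(Complex.I / 2)) + Finsupp.single (dfreq v u) (Complex.I / 2)

/-- window vertex `(a, b, t)`. -/
abbrev vx (a b t : Fin 2) : W 2 := (a, b, t)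

/-- the eight spatial cube edges as (head, tail) pairs (head = coordinate 1, tail = coordinate 0). -/
def spatialEdges : List (W 2 × W 2) :=
  [(vx 1 0 0, vx 0 0 0), (vx 1 0 1, vx 0 0 1), (vx 1 1 0, vx 0 1 0), (vx 1 1 1, vx 0 1 1),
   (vx 0 1 0, vx 0 0 0), (vx 0 1 1, vx 0 0 1), (vx 1 1 0, vx 1 0 0), (vx 1 1 1, vx 1 0 1)]

/-- the four temporal cube edges as (later, earlier) pairs. -/
def temporalEdges : List (W 2 × W 2) :=
  [(vx 0 0 1, vx 0 0 0), (vx 0 1 1, vx 0 1 0), (vx 1 0 1, vx 1 0 0), (vx 1 1 1, vx 1 1 0)]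

/-- spatial part of the witness: `Σ_{8 spatial edges} (1 − cos Δ_eφ)`. -/
def spatialTab : Table 2 := (spatialEdges.map fun e => cosTab e.1 e.2).sum

/-- temporal cosine part: `Σ_{4 temporal edges} (1 − cos Δ_eφ)`. -/
def temporalCosTab : Table 2 := (temporalEdges.map fun e => cosTab e.1 e.2).sum

/-- temporal sine (Berry-like, time-odd) part: `Σ_{4 temporal edges} sin Δ_eφ`. -/
def temporalSinTab : Table 2 := (temporalEdges.map fun e => sinTab e.1 e.2).sum

/-- THE WITNESS TABLE `c_{ε₁,ε₂}`. -/
def witness (ε₁ ε₂ : ℝ) : Table 2 :=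
  spatialTab + ((1 : ℂ) + Complex.I * ε₁) • temporalCosTab + (Complex.I * ε₂) • temporalSinTab

/-! ### §3a Evaluation lemmas for tables built from `Finsupp.single` -/

section eval
variable {r : ℕ}

/-- the character `e_n(φ) = exp(i n·φ)`. -/
def ch (n : Freq r) (φ : W r → ℝ) : ℂ := Complex.exp (Complex.I * ((∑ w, (n w : ℝ) * φ w : ℝ) : ℂ))

theorem genF_add (c₁ c₂ : Table r) (φ : W r → ℝ) : genF (c₁ + c₂) φ = genF c₁ φ + genF c₂ φ := by
  unfold genF
  exact Finsupp.sum_add_index' (fun n => by simp) (fun n a b => by ring)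

theorem genF_smul (b : ℂ) (c : Table r) (φ : W r → ℝ) : genF (b • c) φ = b * genF c φ := by
  unfold genF
  rw [Finsupp.sum_smul_index' (fun n => by simp), Finsupp.mul_sum]
  simp only [smul_eq_mul, mul_assoc]

theorem genF_single (n : Freq r) (a : ℂ) (φ : W r → ℝ) :
    genF (Finsupp.single n a) φ = a * ch n φ := by
  unfold genF ch
  rw [Finsupp.sum_single_index]
  simp

/-- total coefficient sum `Σ_n c_n` (so that `CondN c ↔ tsum c = 0`). -/
def tsum (c : Table r) : ℂ := c.sum (fun _ a => a)

theorem condN_iff (c : Table r) : CondN c ↔ tsum c = 0 := Iff.rfl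

theorem tsum_add (c₁ c₂ : Table r) : tsum (c₁ + c₂) = tsum c₁ + tsum c₂ :=
  Finsupp.sum_add_index' (fun _ => rfl) (fun _ _ _ => rfl)

theorem tsum_smul (b : ℂ) (c : Table r) : tsum (b • c) = b * tsum c := by
  unfold tsum
  rw [Finsupp.sum_smul_index' (fun _ => rfl), Finsupp.mul_sum]
  simp only [smul_eq_mul]

theorem tsum_single (n : Freq r) (a : ℂ) : tsum (Finsupp.single n a) = a :=
  Finsupp.sum_single_index rfl

theorem tsum_zero : tsum (0 : Table r) = 0 := by simp [tsum]

/-- the exponentially weighted `ℓ¹` norm of (A) (so that `CondA B c ↔ normA c ≤ B`). -/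
def normA (c : Table r) : ℝ := c.sum (fun n a => ‖a‖ * Real.exp (∑ w, |(n w : ℝ)|))

theorem condA_iff (B : ℝ) (c : Table r) : CondA B c ↔ normA c ≤ B := Iff.rfl

theorem normA_add_le (c₁ c₂ : Table r) : normA (c₁ + c₂) ≤ normA c₁ + normA c₂ := by
  classical
  unfold normA
  have h0 : ∀ i ∈ c₁.support ∪ c₂.support,
      (fun (n : Freq r) (a : ℂ) => ‖a‖ * Real.exp (∑ w, |(n w : ℝ)|)) i 0 = 0 := fun i _ => by simp
  rw [Finsupp.sum_of_support_subset (c₁ + c₂) Finsupp.support_add _ h0,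
    Finsupp.sum_of_support_subset c₁ Finset.subset_union_left _ h0,
    Finsupp.sum_of_support_subset c₂ Finset.subset_union_right _ h0, ← Finset.sum_add_distrib]
  refine Finset.sum_le_sum fun i _ => ?_
  rw [Finsupp.add_apply, ← add_mul]
  exact mul_le_mul_of_nonneg_right (norm_add_le _ _) (Real.exp_nonneg _)

theorem normA_smul (b : ℂ) (c : Table r) : normA (b • c) = ‖b‖ * normA c := by
  unfold normA
  rw [Finsupp.sum_smul_index' (fun _ => by simp), Finsupp.mul_sum]
  simp only [smul_eq_mul, norm_mul, mul_assoc]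

theorem normA_single (n : Freq r) (a : ℂ) :
    normA (Finsupp.single n a) = ‖a‖ * Real.exp (∑ w, |(n w : ℝ)|) := by
  unfold normA
  exact Finsupp.sum_single_index (by simp)

theorem normA_nonneg (c : Table r) : 0 ≤ normA c :=
  Finset.sum_nonneg fun _ _ => mul_nonneg (norm_nonneg _) (Real.exp_nonneg _)

theorem normA_zero : normA (0 : Table r) = 0 := by simp [normA]

theorem condU1_add {c₁ c₂ : Table r} (h₁ : CondU1 c₁) (h₂ : CondU1 c₂) : CondU1 (c₁ + c₂) := by
  classical
  intro n hn
  rcases Finset.mem_union.1 (Finsupp.support_add hn) with h | h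
  exacts [h₁ n h, h₂ n h]

theorem condU1_smul (b : ℂ) {c : Table r} (h : CondU1 c) : CondU1 (b • c) :=
  fun n hn => h n (Finsupp.support_smul hn)

theorem condU1_single {n : Freq r} (hn : ∑ w, n w = 0) (a : ℂ) : CondU1 (Finsupp.single n a) := by
  intro m hm
  have := Finsupp.support_single_subset hm
  rw [Finset.mem_singleton] at this
  subst this
  exact hn

theorem genF_zero (φ : W r → ℝ) : genF (0 : Table r) φ = 0 := by simp [genF]

theorem genF_list_sum (l : List (Table r)) (φ : W r → ℝ) :
    genF l.sum φ = (l.map fun c => genF c φ).sum := by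
  induction l with
  | nil => simp [genF_zero]
  | cons a l ih => simp [List.sum_cons, genF_add, ih]

theorem tsum_list_sum (l : List (Table r)) : tsum l.sum = (l.map tsum).sum := by
  induction l with
  | nil => simp [tsum]
  | cons a l ih => simp [List.sum_cons, tsum_add, ih]

theorem normA_list_sum_le (l : List (Table r)) : normA l.sum ≤ (l.map normA).sum := by
  induction l with
  | nil => simp [normA]
  | cons a l ih => simpa [List.sum_cons] using (normA_add_le a l.sum).trans (by linarith)

theorem condU1_zero : CondU1 (0 : Table r) := fun n hn => by simp at hn

theorem condU1_list_sum (l : List (Table r)) (h : ∀ c ∈ l, CondU1 c) : CondU1 l.sum := by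
  induction l with
  | nil => simpa using condU1_zero
  | cons a l ih =>
    rw [List.sum_cons]
    exact condU1_add (h a (by simp)) (ih fun c hc => h c (by simp [hc]))

end eval

/-! ### §3b The building blocks evaluate to `1 − cos` and `sin` -/

theorem ch_zero (φ : W 2 → ℝ) : ch (0 : Freq 2) φ = 1 := by simp [ch]

theorem sum_dfreq_mul (u v : W 2) (φ : W 2 → ℝ) :
    (∑ w, ((dfreq u v w : ℤ) : ℝ) * φ w) = φ u - φ v := by
  simp [dfreq, Pi.single_apply, sub_mul, Finset.sum_sub_distrib]

theorem ch_dfreq (u v : W 2) (φ : W 2 → ℝ) :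
    ch (dfreq u v) φ = Complex.exp (Complex.I * ((φ u - φ v : ℝ) : ℂ)) := by
  rw [ch, sum_dfreq_mul]

theorem sum_dfreq (u v : W 2) : ∑ w, dfreq u v w = 0 := by
  simp [dfreq, Finset.sum_sub_distrib]

theorem sum_abs_dfreq {u v : W 2} (h : u ≠ v) : (∑ w, |((dfreq u v w : ℤ) : ℝ)|) = 2 := by
  have key : ∀ w, |((dfreq u v w : ℤ) : ℝ)| = (if w = u then 1 else 0) + (if w = v then 1 else 0) := by
    intro w
    by_cases hu : w = u
    · subst hu; simp [dfreq, h]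
    · by_cases hv : w = v
      · subst hv; simp [dfreq, hu]
      · simp [dfreq, hu, hv]
  simp_rw [key]
  rw [Finset.sum_add_distrib, Finset.sum_ite_eq', Finset.sum_ite_eq']
  simp; norm_num

theorem genF_cosTab (u v : W 2) (φ : W 2 → ℝ) :
    genF (cosTab u v) φ = ((1 - Real.cos (φ u - φ v) : ℝ) : ℂ) := by
  have e1 : ch (dfreq u v) φ = Complex.exp (((φ u - φ v : ℝ) : ℂ) * Complex.I) := by
    rw [ch_dfreq, mul_comm]
  have e2 : ch (dfreq v u) φ = Complex.exp (-((φ u - φ v : ℝ) : ℂ) * Complex.I) := by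
    rw [ch_dfreq]; congr 1; push_cast; ring
  have h2 := Complex.two_cos ((φ u - φ v : ℝ) : ℂ)
  simp only [cosTab, genF_add, genF_single, ch_zero, e1, e2]
  push_cast at h2 ⊢
  linear_combination (1/2 : ℂ) * h2

theorem genF_sinTab (u v : W 2) (φ : W 2 → ℝ) :
    genF (sinTab u v) φ = ((Real.sin (φ u - φ v) : ℝ) : ℂ) := by
  have e1 : ch (dfreq u v) φ = Complex.exp (((φ u - φ v : ℝ) : ℂ) * Complex.I) := by
    rw [ch_dfreq, mul_comm]
  have e2 : ch (dfreq v u) φ = Complex.exp (-((φ u - φ v : ℝ) : ℂ) * Complex.I) := by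
    rw [ch_dfreq]; congr 1; push_cast; ring
  have h2 := Complex.two_sin ((φ u - φ v : ℝ) : ℂ)
  simp only [sinTab, genF_add, genF_single, e1, e2]
  push_cast at h2 ⊢
  linear_combination (-1/2 : ℂ) * h2

theorem tsum_cosTab (u v : W 2) : tsum (cosTab u v) = 0 := by
  simp only [cosTab, tsum_add, tsum_single]; norm_num

theorem tsum_sinTab (u v : W 2) : tsum (sinTab u v) = 0 := by
  simp only [sinTab, tsum_add, tsum_single]; ring

theorem condU1_cosTab (u v : W 2) : CondU1 (cosTab u v) :=
  condU1_add (condU1_add (condU1_single (by simp) _) (condU1_single (sum_dfreq u v) _))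
    (condU1_single (sum_dfreq v u) _)

theorem condU1_sinTab (u v : W 2) : CondU1 (sinTab u v) :=
  condU1_add (condU1_single (sum_dfreq u v) _) (condU1_single (sum_dfreq v u) _)

theorem normA_cosTab {u v : W 2} (h : u ≠ v) : normA (cosTab u v) ≤ 1 + Real.exp 2 := by
  have h' : v ≠ u := fun e => h e.symm
  have e0 : normA (Finsupp.single (0 : Freq 2) (1 : ℂ)) = 1 := by
    rw [normA_single]; simp
  have e1 : normA (Finsupp.single (dfreq u v) (-(1/2 : ℂ))) = (1/2) * Real.exp 2 := by
    rw [normA_single, sum_abs_dfreq h]; simp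
  have e2 : normA (Finsupp.single (dfreq v u) (-(1/2 : ℂ))) = (1/2) * Real.exp 2 := by
    rw [normA_single, sum_abs_dfreq h']; simp
  have s1 := normA_add_le (Finsupp.single (0 : Freq 2) (1 : ℂ) + Finsupp.single (dfreq u v) (-(1/2 : ℂ)))
    (Finsupp.single (dfreq v u) (-(1/2 : ℂ)))
  have s2 := normA_add_le (Finsupp.single (0 : Freq 2) (1 : ℂ)) (Finsupp.single (dfreq u v) (-(1/2 : ℂ)))
  unfold cosTab
  linarith

theorem normA_sinTab {u v : W 2} (h : u ≠ v) : normA (sinTab u v) ≤ Real.exp 2 := by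
  have h' : v ≠ u := fun e => h e.symm
  have e1 : normA (Finsupp.single (dfreq u v) (-(Complex.I / 2))) = (1/2) * Real.exp 2 := by
    rw [normA_single, sum_abs_dfreq h]; simp
  have e2 : normA (Finsupp.single (dfreq v u) (Complex.I / 2)) = (1/2) * Real.exp 2 := by
    rw [normA_single, sum_abs_dfreq h']; simp
  have s1 := normA_add_le (Finsupp.single (dfreq u v) (-(Complex.I / 2)))
    (Finsupp.single (dfreq v u) (Complex.I / 2))
  unfold sinTab
  linarith

theorem condU1_map_cosTab (l : List (W 2 × W 2)) :
    CondU1 (l.map fun e => cosTab e.1 e.2).sum :=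
  condU1_list_sum _ fun c hc => by
    obtain ⟨e, -, rfl⟩ := List.mem_map.1 hc
    exact condU1_cosTab _ _

theorem condU1_map_sinTab (l : List (W 2 × W 2)) :
    CondU1 (l.map fun e => sinTab e.1 e.2).sum :=
  condU1_list_sum _ fun c hc => by
    obtain ⟨e, -, rfl⟩ := List.mem_map.1 hc
    exact condU1_sinTab _ _

/-! ### §3c Properties of the witness table -/

theorem condU1_witness (ε₁ ε₂ : ℝ) : CondU1 (witness ε₁ ε₂) :=
  condU1_add (condU1_add (condU1_map_cosTab _) (condU1_smul _ (condU1_map_cosTab _)))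
    (condU1_smul _ (condU1_map_sinTab _))

theorem condN_witness (ε₁ ε₂ : ℝ) : CondN (witness ε₁ ε₂) := by
  rw [condN_iff]
  simp only [witness, spatialTab, temporalCosTab, temporalSinTab, spatialEdges, temporalEdges,
    tsum_add, tsum_smul, List.map_cons, List.map_nil, List.sum_cons, List.sum_nil,
    tsum_cosTab, tsum_sinTab, tsum_zero]
  ring

theorem normA_spatialTab : normA spatialTab ≤ 8 * (1 + Real.exp 2) := by
  refine (normA_list_sum_le _).trans ?_
  simp only [spatialEdges, List.map_cons, List.map_nil, List.sum_cons, List.sum_nil]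
  have h1 := normA_cosTab (u := vx 1 0 0) (v := vx 0 0 0) (by decide)
  have h2 := normA_cosTab (u := vx 1 0 1) (v := vx 0 0 1) (by decide)
  have h3 := normA_cosTab (u := vx 1 1 0) (v := vx 0 1 0) (by decide)
  have h4 := normA_cosTab (u := vx 1 1 1) (v := vx 0 1 1) (by decide)
  have h5 := normA_cosTab (u := vx 0 1 0) (v := vx 0 0 0) (by decide)
  have h6 := normA_cosTab (u := vx 0 1 1) (v := vx 0 0 1) (by decide)
  have h7 := normA_cosTab (u := vx 1 1 0) (v := vx 1 0 0) (by decide)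
  have h8 := normA_cosTab (u := vx 1 1 1) (v := vx 1 0 1) (by decide)
  simp only [vx] at h1 h2 h3 h4 h5 h6 h7 h8 ⊢
  linarith

theorem normA_temporalCosTab : normA temporalCosTab ≤ 4 * (1 + Real.exp 2) := by
  refine (normA_list_sum_le _).trans ?_
  simp only [temporalEdges, List.map_cons, List.map_nil, List.sum_cons, List.sum_nil]
  have h1 := normA_cosTab (u := vx 0 0 1) (v := vx 0 0 0) (by decide)
  have h2 := normA_cosTab (u := vx 0 1 1) (v := vx 0 1 0) (by decide)
  have h3 := normA_cosTab (u := vx 1 0 1) (v := vx 1 0 0) (by decide)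
  have h4 := normA_cosTab (u := vx 1 1 1) (v := vx 1 1 0) (by decide)
  simp only [vx] at h1 h2 h3 h4 ⊢
  linarith

theorem normA_temporalSinTab : normA temporalSinTab ≤ 4 * Real.exp 2 := by
  refine (normA_list_sum_le _).trans ?_
  simp only [temporalEdges, List.map_cons, List.map_nil, List.sum_cons, List.sum_nil]
  have h1 := normA_sinTab (u := vx 0 0 1) (v := vx 0 0 0) (by decide)
  have h2 := normA_sinTab (u := vx 0 1 1) (v := vx 0 1 0) (by decide)
  have h3 := normA_sinTab (u := vx 1 0 1) (v := vx 1 0 0) (by decide)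
  have h4 := normA_sinTab (u := vx 1 1 1) (v := vx 1 1 0) (by decide)
  simp only [vx] at h1 h2 h3 h4 ⊢
  linarith

theorem exp_two_lt : Real.exp 2 < 7.3891 := by
  have h := Real.exp_one_lt_d9
  have h2 : Real.exp 2 = Real.exp 1 * Real.exp 1 := by rw [← Real.exp_add]; norm_num
  rw [h2]
  nlinarith [Real.exp_pos 1]

theorem norm_one_add_I_mul_le {ε : ℝ} (h : |ε| ≤ 1) : ‖(1 : ℂ) + Complex.I * ε‖ ≤ 3/2 := by
  have hsq : ‖(1 : ℂ) + Complex.I * ε‖ ^ 2 = 1 + ε ^ 2 := by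
    rw [Complex.sq_norm]; simp [Complex.normSq_apply]; ring
  have hε : ε ^ 2 ≤ 1 := by
    have := abs_nonneg ε
    calc ε ^ 2 = |ε| ^ 2 := (sq_abs ε).symm
      _ ≤ 1 := by nlinarith
  nlinarith [norm_nonneg ((1 : ℂ) + Complex.I * ε)]

/-- (A) for the witness: `normA ≤ 8(1+e²) + (3/2)·4(1+e²) + (1/5)·4e² < 128`. -/
theorem condA_witness {ε₁ ε₂ : ℝ} (h₁ : |ε₁| ≤ 1) (h₂ : |ε₂| ≤ 1/5) : CondA 128 (witness ε₁ ε₂) := by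
  rw [condA_iff]
  have hS := normA_spatialTab
  have hC := normA_temporalCosTab
  have hT := normA_temporalSinTab
  have hn₁ := norm_one_add_I_mul_le h₁
  have hn₂ : ‖Complex.I * (ε₂ : ℂ)‖ ≤ 1/5 := by simpa using h₂
  have he := exp_two_lt
  have hC0 := normA_nonneg temporalCosTab
  have hT0 := normA_nonneg temporalSinTab
  have step1 := normA_add_le (spatialTab + ((1 : ℂ) + Complex.I * ε₁) • temporalCosTab)
    ((Complex.I * ε₂) • temporalSinTab)
  have step2 := normA_add_le spatialTab (((1 : ℂ) + Complex.I * ε₁) • temporalCosTab)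
  rw [normA_smul] at step1 step2
  have b1 : ‖(1 : ℂ) + Complex.I * ε₁‖ * normA temporalCosTab ≤ (3/2) * (4 * (1 + Real.exp 2)) :=
    mul_le_mul hn₁ hC hC0 (by norm_num)
  have b2 : ‖Complex.I * (ε₂ : ℂ)‖ * normA temporalSinTab ≤ (1/5) * (4 * Real.exp 2) :=
    mul_le_mul hn₂ hT hT0 (by norm_num)
  unfold witness
  linarith

theorem cos_sub_comm' (a b : ℝ) : Real.cos (a - b) = Real.cos (b - a) := by
  rw [← Real.cos_neg, neg_sub]

/-- the elementary path inequality `1 − cos(x−z) ≤ 2(1−cos(x−y)) + 2(1−cos(y−z))`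
(i.e. `|1 − e^{i(a+b)}|² ≤ 2|1−e^{ia}|² + 2|1−e^{ib}|²`). -/
theorem cos_path2 (x y z : ℝ) :
    1 - Real.cos (x - z) ≤ 2 * (1 - Real.cos (x - y)) + 2 * (1 - Real.cos (y - z)) := by
  have hx : x - z = 2 * ((x - y) / 2 + (y - z) / 2) := by ring
  set a := (x - y) / 2 with ha
  set b := (y - z) / 2 with hb
  have h1 : 1 - Real.cos (x - z) = 2 * Real.sin (a + b) ^ 2 := by
    rw [hx, Real.cos_two_mul, Real.cos_sq']; ring
  have h2 : 1 - Real.cos (x - y) = 2 * Real.sin a ^ 2 := by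
    rw [show x - y = 2 * a by rw [ha]; ring, Real.cos_two_mul, Real.cos_sq']; ring
  have h3 : 1 - Real.cos (y - z) = 2 * Real.sin b ^ 2 := by
    rw [show y - z = 2 * b by rw [hb]; ring, Real.cos_two_mul, Real.cos_sq']; ring
  rw [h1, h2, h3, Real.sin_add]
  have ca := Real.cos_sq_le_one a
  have cb := Real.cos_sq_le_one b
  nlinarith [mul_self_nonneg (Real.sin a * Real.cos b - Real.cos a * Real.sin b),
    mul_nonneg (sq_nonneg (Real.sin a)) (sub_nonneg.2 cb),
    mul_nonneg (sq_nonneg (Real.sin b)) (sub_nonneg.2 ca)]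

/-- length-three chaining with the constants `(2,4,4)` (enough for `c₀ = 1/18`). -/
theorem cos_path3 (x y z t : ℝ) :
    1 - Real.cos (x - t) ≤ 2 * (1 - Real.cos (x - y)) + 4 * (1 - Real.cos (y - z)) +
      4 * (1 - Real.cos (z - t)) := by
  have h1 := cos_path2 x y t
  have h2 := cos_path2 y z t
  linarith

/-- real part of the witness generating function: the twelve cube edges, unit weight each. -/
def S12 (φ : W 2 → ℝ) : ℝ :=
  (1 - Real.cos (φ (1, 0, 0) - φ (0, 0, 0))) + (1 - Real.cos (φ (1, 0, 1) - φ (0, 0, 1))) +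
  (1 - Real.cos (φ (1, 1, 0) - φ (0, 1, 0))) + (1 - Real.cos (φ (1, 1, 1) - φ (0, 1, 1))) +
  (1 - Real.cos (φ (0, 1, 0) - φ (0, 0, 0))) + (1 - Real.cos (φ (0, 1, 1) - φ (0, 0, 1))) +
  (1 - Real.cos (φ (1, 1, 0) - φ (1, 0, 0))) + (1 - Real.cos (φ (1, 1, 1) - φ (1, 0, 1))) +
  (1 - Real.cos (φ (0, 0, 1) - φ (0, 0, 0))) + (1 - Real.cos (φ (0, 1, 1) - φ (0, 1, 0))) +
  (1 - Real.cos (φ (1, 0, 1) - φ (1, 0, 0))) + (1 - Real.cos (φ (1, 1, 1) - φ (1, 1, 0)))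

theorem genF_witness_re (ε₁ ε₂ : ℝ) (φ : W 2 → ℝ) : (genF (witness ε₁ ε₂) φ).re = S12 φ := by
  simp only [witness, spatialTab, temporalCosTab, temporalSinTab, spatialEdges, temporalEdges,
    List.map_cons, List.map_nil, List.sum_cons, List.sum_nil, genF_add, genF_smul,
    genF_cosTab, genF_sinTab, vx, S12, add_zero, Complex.add_re, Complex.add_im,
    Complex.mul_re, Complex.mul_im, Complex.ofReal_re, Complex.ofReal_im, Complex.I_re, Complex.I_im,
    Complex.one_re, Complex.one_im]
  ring

/-- (C) COERCIVITY of the witness with `c₀ = 1/18` (bit-fixing routing on the cube; every undirected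
edge carries weighted load ≤ 18). -/
theorem condC_witness (ε₁ ε₂ : ℝ) : CondC (1/18) (witness ε₁ ε₂) := by
  intro φ
  rw [genF_witness_re]
  simp only [S12, Fintype.sum_prod_type, Fin.sum_univ_two, sub_self, Real.cos_zero]
  have s1 : Real.cos (φ (0, 0, 0) - φ (1, 0, 0)) = Real.cos (φ (1, 0, 0) - φ (0, 0, 0)) := cos_sub_comm' _ _
  have n1 : 0 ≤ 1 - Real.cos (φ (1, 0, 0) - φ (0, 0, 0)) := sub_nonneg.2 (Real.cos_le_one _)
  have s2 : Real.cos (φ (0, 0, 0) - φ (0, 1, 0)) = Real.cos (φ (0, 1, 0) - φ (0, 0, 0)) := cos_sub_comm' _ _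
  have n2 : 0 ≤ 1 - Real.cos (φ (0, 1, 0) - φ (0, 0, 0)) := sub_nonneg.2 (Real.cos_le_one _)
  have s3 : Real.cos (φ (0, 0, 0) - φ (0, 0, 1)) = Real.cos (φ (0, 0, 1) - φ (0, 0, 0)) := cos_sub_comm' _ _
  have n3 : 0 ≤ 1 - Real.cos (φ (0, 0, 1) - φ (0, 0, 0)) := sub_nonneg.2 (Real.cos_le_one _)
  have s4 : Real.cos (φ (0, 0, 1) - φ (1, 0, 1)) = Real.cos (φ (1, 0, 1) - φ (0, 0, 1)) := cos_sub_comm' _ _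
  have n4 : 0 ≤ 1 - Real.cos (φ (1, 0, 1) - φ (0, 0, 1)) := sub_nonneg.2 (Real.cos_le_one _)
  have s5 : Real.cos (φ (0, 0, 1) - φ (0, 1, 1)) = Real.cos (φ (0, 1, 1) - φ (0, 0, 1)) := cos_sub_comm' _ _
  have n5 : 0 ≤ 1 - Real.cos (φ (0, 1, 1) - φ (0, 0, 1)) := sub_nonneg.2 (Real.cos_le_one _)
  have s6 : Real.cos (φ (0, 1, 0) - φ (1, 1, 0)) = Real.cos (φ (1, 1, 0) - φ (0, 1, 0)) := cos_sub_comm' _ _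
  have n6 : 0 ≤ 1 - Real.cos (φ (1, 1, 0) - φ (0, 1, 0)) := sub_nonneg.2 (Real.cos_le_one _)
  have s7 : Real.cos (φ (0, 1, 0) - φ (0, 1, 1)) = Real.cos (φ (0, 1, 1) - φ (0, 1, 0)) := cos_sub_comm' _ _
  have n7 : 0 ≤ 1 - Real.cos (φ (0, 1, 1) - φ (0, 1, 0)) := sub_nonneg.2 (Real.cos_le_one _)
  have s8 : Real.cos (φ (0, 1, 1) - φ (1, 1, 1)) = Real.cos (φ (1, 1, 1) - φ (0, 1, 1)) := cos_sub_comm' _ _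
  have n8 : 0 ≤ 1 - Real.cos (φ (1, 1, 1) - φ (0, 1, 1)) := sub_nonneg.2 (Real.cos_le_one _)
  have s9 : Real.cos (φ (1, 0, 0) - φ (1, 1, 0)) = Real.cos (φ (1, 1, 0) - φ (1, 0, 0)) := cos_sub_comm' _ _
  have n9 : 0 ≤ 1 - Real.cos (φ (1, 1, 0) - φ (1, 0, 0)) := sub_nonneg.2 (Real.cos_le_one _)
  have s10 : Real.cos (φ (1, 0, 0) - φ (1, 0, 1)) = Real.cos (φ (1, 0, 1) - φ (1, 0, 0)) := cos_sub_comm' _ _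
  have n10 : 0 ≤ 1 - Real.cos (φ (1, 0, 1) - φ (1, 0, 0)) := sub_nonneg.2 (Real.cos_le_one _)
  have s11 : Real.cos (φ (1, 0, 1) - φ (1, 1, 1)) = Real.cos (φ (1, 1, 1) - φ (1, 0, 1)) := cos_sub_comm' _ _
  have n11 : 0 ≤ 1 - Real.cos (φ (1, 1, 1) - φ (1, 0, 1)) := sub_nonneg.2 (Real.cos_le_one _)
  have s12 : Real.cos (φ (1, 1, 0) - φ (1, 1, 1)) = Real.cos (φ (1, 1, 1) - φ (1, 1, 0)) := cos_sub_comm' _ _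
  have n12 : 0 ≤ 1 - Real.cos (φ (1, 1, 1) - φ (1, 1, 0)) := sub_nonneg.2 (Real.cos_le_one _)
  have p1 := cos_path2 (φ (0, 0, 0)) (φ (0, 1, 0)) (φ (0, 1, 1))
  have p2 := cos_path2 (φ (0, 0, 0)) (φ (1, 0, 0)) (φ (1, 0, 1))
  have p3 := cos_path2 (φ (0, 0, 0)) (φ (1, 0, 0)) (φ (1, 1, 0))
  have q1 := cos_path3 (φ (0, 0, 0)) (φ (1, 0, 0)) (φ (1, 1, 0)) (φ (1, 1, 1))
  have p4 := cos_path2 (φ (0, 0, 1)) (φ (0, 1, 1)) (φ (0, 1, 0))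
  have p5 := cos_path2 (φ (0, 0, 1)) (φ (1, 0, 1)) (φ (1, 0, 0))
  have q2 := cos_path3 (φ (0, 0, 1)) (φ (1, 0, 1)) (φ (1, 1, 1)) (φ (1, 1, 0))
  have p6 := cos_path2 (φ (0, 0, 1)) (φ (1, 0, 1)) (φ (1, 1, 1))
  have p7 := cos_path2 (φ (0, 1, 0)) (φ (0, 0, 0)) (φ (0, 0, 1))
  have p8 := cos_path2 (φ (0, 1, 0)) (φ (1, 1, 0)) (φ (1, 0, 0))
  have q3 := cos_path3 (φ (0, 1, 0)) (φ (1, 1, 0)) (φ (1, 0, 0)) (φ (1, 0, 1))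
  have p9 := cos_path2 (φ (0, 1, 0)) (φ (1, 1, 0)) (φ (1, 1, 1))
  have p10 := cos_path2 (φ (0, 1, 1)) (φ (0, 0, 1)) (φ (0, 0, 0))
  have q4 := cos_path3 (φ (0, 1, 1)) (φ (1, 1, 1)) (φ (1, 0, 1)) (φ (1, 0, 0))
  have p11 := cos_path2 (φ (0, 1, 1)) (φ (1, 1, 1)) (φ (1, 0, 1))
  have p12 := cos_path2 (φ (0, 1, 1)) (φ (1, 1, 1)) (φ (1, 1, 0))
  have p13 := cos_path2 (φ (1, 0, 0)) (φ (0, 0, 0)) (φ (0, 0, 1))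
  have p14 := cos_path2 (φ (1, 0, 0)) (φ (0, 0, 0)) (φ (0, 1, 0))
  have q5 := cos_path3 (φ (1, 0, 0)) (φ (0, 0, 0)) (φ (0, 1, 0)) (φ (0, 1, 1))
  have p15 := cos_path2 (φ (1, 0, 0)) (φ (1, 1, 0)) (φ (1, 1, 1))
  have p16 := cos_path2 (φ (1, 0, 1)) (φ (0, 0, 1)) (φ (0, 0, 0))
  have q6 := cos_path3 (φ (1, 0, 1)) (φ (0, 0, 1)) (φ (0, 1, 1)) (φ (0, 1, 0))
  have p17 := cos_path2 (φ (1, 0, 1)) (φ (0, 0, 1)) (φ (0, 1, 1))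
  have p18 := cos_path2 (φ (1, 0, 1)) (φ (1, 1, 1)) (φ (1, 1, 0))
  have p19 := cos_path2 (φ (1, 1, 0)) (φ (0, 1, 0)) (φ (0, 0, 0))
  have q7 := cos_path3 (φ (1, 1, 0)) (φ (0, 1, 0)) (φ (0, 0, 0)) (φ (0, 0, 1))
  have p20 := cos_path2 (φ (1, 1, 0)) (φ (0, 1, 0)) (φ (0, 1, 1))
  have p21 := cos_path2 (φ (1, 1, 0)) (φ (1, 0, 0)) (φ (1, 0, 1))
  have q8 := cos_path3 (φ (1, 1, 1)) (φ (0, 1, 1)) (φ (0, 0, 1)) (φ (0, 0, 0))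
  have p22 := cos_path2 (φ (1, 1, 1)) (φ (0, 1, 1)) (φ (0, 0, 1))
  have p23 := cos_path2 (φ (1, 1, 1)) (φ (0, 1, 1)) (φ (0, 1, 0))
  have p24 := cos_path2 (φ (1, 1, 1)) (φ (1, 0, 1)) (φ (1, 0, 0))
  linarith

/-- THE WITNESS IS ADMISSIBLE (sorry-free): `(U1) ∧ (N) ∧ (A) ∧ (C)` with `r = 2`, `B = 128`,
`c₀ = 1/18`, for all `|ε₁| ≤ 1`, `|ε₂| ≤ 1/5`. -/
theorem witness_admissible {ε₁ ε₂ : ℝ} (h₁ : |ε₁| ≤ 1) (h₂ : |ε₂| ≤ 1/5) :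
    Admissible 2 128 (1/18) (witness ε₁ ε₂) :=
  ⟨condU1_witness ε₁ ε₂, condN_witness ε₁ ε₂, condA_witness h₁ h₂, condC_witness ε₁ ε₂⟩

/-- The analytic heart (NEAR-MISS, `sorry`): for the witness family, zeros of `Z` occur at arbitrarily large
`K`, for every lower bound `L₀` on the sizes, with `|ε₁| ≤ 1`, `|ε₂| ≤ 1/5`.
WHAT A PROOF NEEDS (fixed `L`, all soft analysis at fixed `L` except the last point):
(i) `Z = Tr T^M` with `T` trace class on `L²(𝕋^{L²})`, sector decomposition by total charge `Q`;
(ii) the gauge identity above (exact), reducing the `ε₂`-dependence to `e^{iQψ}`;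
(iii) for real stiffness the sector tops satisfy `μ₀ > μ₁ > …` (Perron–Frobenius within sectors + a
    rotor-gap estimate), so `Im ψ = log(μ₀/μ₁)` produces an exact modulus tie of two different sectors;
(iv) NON-DEGENERACY: `∂_{ε₁} arg(μ₁/μ₀)(κ(1+iε₁)) − ∂_{ε₁} Re ψ ≠ 0` at the tie (numerically `≈ 1/(4κ_eff²)`;
    for `L = 1` this is an explicit Bessel-function inequality `d/dκ[κ log(I₀(κ)/I₁(κ))] ≠ 0`);
(v) a uniform bound `Σ_{rest} |λ_j|^M ≤ C q^M |λ₀|^M`, `q < 1`, at fixed `(L, K)` and small `ε`;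
(vi) degree theory in the `(ε₁, ε₂)` plane for large `M`.
Evidence: j004976 (L = 1 exact sector: ten Newton-certified transversal zeros, κ = 8…128) and j014041–j014043
(L = 2 FULL transfer operator, K = 0.25/0.5/1.0: zeros at M = 172/1478/7459, |ζ| ≤ 2.4e-11, winding −1) —
tables in the §3 docblock.  Obstruction to a Lean proof: (i)–(vi) need spectral theory of compact
non-self-adjoint operators and 2-D degree theory far beyond present Mathlib coverage of this model. -/
def WitnessZeroExists : Prop :=
  ∀ (K₀ : ℝ) (L₀ : ℕ), ∃ K : ℝ, K₀ ≤ K ∧ ∃ ε₁ ε₂ : ℝ, |ε₁| ≤ 1 ∧ |ε₂| ≤ 1/5 ∧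
    ∃ (L M : ℕ) (_ : NeZero L) (_ : NeZero M), L₀ ≤ L ∧ L ≤ M ∧ partZ K (witness ε₁ ε₂) L M = 0

theorem witness_zero_exists : WitnessZeroExists := by
  sorry

/-- Pure logic (sorry-free): admissibility of the witness family + zeros of `Z` refute the crux. -/
theorem birComplexStableXY_false_of
    (hadm : ∀ ε₁ ε₂ : ℝ, |ε₁| ≤ 1 → |ε₂| ≤ 1/5 → Admissible 2 128 (1/18) (witness ε₁ ε₂))
    (hzero : WitnessZeroExists) : ¬ BirComplexStableXY := by
  rw [← engineClaim_admissible_iff]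
  intro h
  obtain ⟨K₀, L₀, hK⟩ := h 2 128 (1/18) le_rfl (by norm_num)
  obtain ⟨K, hKK, ε₁, ε₂, h1, h2, L, M, _, _, hL, hLM, hZ⟩ := hzero K₀ L₀
  exact (hK K hKK (witness ε₁ ε₂) (hadm ε₁ ε₂ h1 h2) L M hL hLM).1 hZ

/-- ¬ crux, MODULO the sorried analytic heart `witness_zero_exists` (everything else is checked:
the witness is admissible with `r = 2, B = 128, c₀ = 1/18`).  NOT a landable refutation yet. -/
theorem birComplexStableXY_false : ¬ BirComplexStableXY :=
  birComplexStableXY_false_of (fun _ _ h₁ h₂ => witness_admissible h₁ h₂) witness_zero_exists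

/-! ### §3d What lattice model the witness defines (bookkeeping for the numerics)

Summed over window translates, the witness table is EXACTLY the nearest-neighbour anisotropic XY action with
every bond counted four times (each cube-edge direction occurs four times in the window):
`A(θ) = 4K Σ_s [(1−cos ∂₁θ) + (1−cos ∂₂θ) + (1+iε₁)(1−cos ∂_τθ) + iε₂ sin ∂_τθ](s)`.
This is the model whose transfer operator jobs j005270/j006369/j006015/j006016 diagonalise (L = 2) and
whose `L = 1` specialisation (spatial differences vanish) is the rotor chain of j004976 with `κ = 4K`. -/

/-- dir-1 spatial part `Σ_{b,t} (1 − cos(φ(1,b,t) − φ(0,b,t)))` as a real function. -/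
def S4dir1 (φ : W 2 → ℝ) : ℝ :=
  (1 - Real.cos (φ (1, 0, 0) - φ (0, 0, 0))) + (1 - Real.cos (φ (1, 0, 1) - φ (0, 0, 1))) +
  (1 - Real.cos (φ (1, 1, 0) - φ (0, 1, 0))) + (1 - Real.cos (φ (1, 1, 1) - φ (0, 1, 1)))
/-- dir-2 spatial part. -/
def S4dir2 (φ : W 2 → ℝ) : ℝ :=
  (1 - Real.cos (φ (0, 1, 0) - φ (0, 0, 0))) + (1 - Real.cos (φ (0, 1, 1) - φ (0, 0, 1))) +
  (1 - Real.cos (φ (1, 1, 0) - φ (1, 0, 0))) + (1 - Real.cos (φ (1, 1, 1) - φ (1, 0, 1)))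
/-- temporal cosine part. -/
def T4cos (φ : W 2 → ℝ) : ℝ :=
  (1 - Real.cos (φ (0, 0, 1) - φ (0, 0, 0))) + (1 - Real.cos (φ (0, 1, 1) - φ (0, 1, 0))) +
  (1 - Real.cos (φ (1, 0, 1) - φ (1, 0, 0))) + (1 - Real.cos (φ (1, 1, 1) - φ (1, 1, 0)))
/-- temporal sine (Berry-like) part. -/
def T4sin (φ : W 2 → ℝ) : ℝ :=
  Real.sin (φ (0, 0, 1) - φ (0, 0, 0)) + Real.sin (φ (0, 1, 1) - φ (0, 1, 0)) +
  Real.sin (φ (1, 0, 1) - φ (1, 0, 0)) + Real.sin (φ (1, 1, 1) - φ (1, 1, 0))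

/-- the witness generating function in closed form. -/
theorem genF_witness_eq (ε₁ ε₂ : ℝ) (φ : W 2 → ℝ) :
    genF (witness ε₁ ε₂) φ = (S4dir1 φ : ℂ) + (S4dir2 φ : ℂ) + ((1 : ℂ) + Complex.I * ε₁) * (T4cos φ : ℂ) +
      (Complex.I * ε₂) * (T4sin φ : ℂ) := by
  simp only [witness, spatialTab, temporalCosTab, temporalSinTab, spatialEdges, temporalEdges,
    List.map_cons, List.map_nil, List.sum_cons, List.sum_nil, genF_add, genF_smul,
    genF_cosTab, genF_sinTab, vx, S4dir1, S4dir2, T4cos, T4sin, add_zero]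
  push_cast
  ring

section lattice
variable (L M : ℕ) [NeZero L] [NeZero M]

theorem sum_shift (off : Λ L M) (g : Λ L M → ℂ) : ∑ s, g (s + off) = ∑ s, g s :=
  Equiv.sum_comp (Equiv.addRight off) g

/-- translation invariance of the window sum, dir-1 spatial edges. -/
theorem sum_edge_dir1 (b t : Fin 2) (f : ℝ → ℂ) (θ : Λ L M → ℝ) :
    ∑ s : Λ L M, f (θ (sh L M s (vx 1 b t)) - θ (sh L M s (vx 0 b t))) =
      ∑ s : Λ L M, f (θ (s.1 + ![1, 0], s.2) - θ s) := by
  rw [← sum_shift L M ((![0, ((b : ℕ) : ZMod L)], ((t : ℕ) : ZMod M)) : Λ L M)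
    (fun s => f (θ (s.1 + ![1, 0], s.2) - θ s))]
  refine Finset.sum_congr rfl fun s _ => ?_
  congr 3
  · refine Prod.ext ?_ ?_
    · ext i; fin_cases i <;> simp [sh, Matrix.vecHead, Matrix.vecTail]
    · simp [sh]
  · refine Prod.ext ?_ ?_
    · ext i; fin_cases i <;> simp [sh, Matrix.vecHead, Matrix.vecTail]
    · simp [sh]

/-- translation invariance of the window sum, dir-2 spatial edges. -/
theorem sum_edge_dir2 (a t : Fin 2) (f : ℝ → ℂ) (θ : Λ L M → ℝ) :
    ∑ s : Λ L M, f (θ (sh L M s (vx a 1 t)) - θ (sh L M s (vx a 0 t))) =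
      ∑ s : Λ L M, f (θ (s.1 + ![0, 1], s.2) - θ s) := by
  rw [← sum_shift L M ((![((a : ℕ) : ZMod L), 0], ((t : ℕ) : ZMod M)) : Λ L M)
    (fun s => f (θ (s.1 + ![0, 1], s.2) - θ s))]
  refine Finset.sum_congr rfl fun s _ => ?_
  congr 3
  · refine Prod.ext ?_ ?_
    · ext i; fin_cases i <;> simp [sh, Matrix.vecHead, Matrix.vecTail]
    · simp [sh]
  · refine Prod.ext ?_ ?_
    · ext i; fin_cases i <;> simp [sh, Matrix.vecHead, Matrix.vecTail]
    · simp [sh]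

/-- translation invariance of the window sum, temporal edges. -/
theorem sum_edge_time (a b : Fin 2) (f : ℝ → ℂ) (θ : Λ L M → ℝ) :
    ∑ s : Λ L M, f (θ (sh L M s (vx a b 1)) - θ (sh L M s (vx a b 0))) =
      ∑ s : Λ L M, f (θ (s.1, s.2 + 1) - θ s) := by
  rw [← sum_shift L M ((![((a : ℕ) : ZMod L), ((b : ℕ) : ZMod L)], (0 : ZMod M)) : Λ L M)
    (fun s => f (θ (s.1, s.2 + 1) - θ s))]
  refine Finset.sum_congr rfl fun s _ => ?_
  congr 3
  · refine Prod.ext ?_ ?_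
    · ext i; fin_cases i <;> simp [sh, Matrix.vecHead, Matrix.vecTail]
    · simp [sh]
  · refine Prod.ext ?_ ?_
    · ext i; fin_cases i <;> simp [sh, Matrix.vecHead, Matrix.vecTail]
    · simp [sh]

/-- THE SUMMED ACTION OF THE WITNESS = 4 × nearest-neighbour anisotropic XY with complex temporal
stiffness `1 + iε₁` and Berry-like term `iε₂ sin ∂_τθ` (the model of the numerics). -/
theorem action_witness (ε₁ ε₂ K : ℝ) (θ : Λ L M → ℝ) :
    action K (witness ε₁ ε₂) L M θ = 4 * (K : ℂ) * ∑ s : Λ L M,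
      ( (((1 - Real.cos (θ (s.1 + ![1, 0], s.2) - θ s) : ℝ)) : ℂ)
      + (((1 - Real.cos (θ (s.1 + ![0, 1], s.2) - θ s) : ℝ)) : ℂ)
      + ((1 : ℂ) + Complex.I * ε₁) * (((1 - Real.cos (θ (s.1, s.2 + 1) - θ s) : ℝ)) : ℂ)
      + (Complex.I * ε₂) * ((Real.sin (θ (s.1, s.2 + 1) - θ s) : ℝ) : ℂ) ) := by
  unfold action
  simp_rw [genF_witness_eq]
  simp only [S4dir1, S4dir2, T4cos, T4sin, Complex.ofReal_add, Finset.sum_add_distrib, Finset.mul_sum,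
    mul_add, add_mul]
  have d1 := fun (b t : Fin 2) => sum_edge_dir1 L M b t (fun x => (((1 - Real.cos x : ℝ)) : ℂ)) θ
  have d2 := fun (a t : Fin 2) => sum_edge_dir2 L M a t (fun x => (((1 - Real.cos x : ℝ)) : ℂ)) θ
  have dc := fun (a b : Fin 2) => sum_edge_time L M a b (fun x => (((1 - Real.cos x : ℝ)) : ℂ)) θ
  have ds := fun (a b : Fin 2) => sum_edge_time L M a b (fun x => ((Real.sin x : ℝ) : ℂ)) θ
  simp only [vx] at d1 d2 dc ds
  -- pull the constant factors out of the temporal sums, then use translation invariance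
  simp only [← Finset.mul_sum]
  rw [d1 0 0, d1 0 1, d1 1 0, d1 1 1, d2 0 0, d2 0 1, d2 1 0, d2 1 1, dc 0 0, dc 0 1, dc 1 0, dc 1 1,
    ds 0 0, ds 0 1, ds 1 0, ds 1 1]
  simp only [Finset.mul_sum, ← Finset.sum_add_distrib]
  refine Finset.sum_congr rfl fun s _ => ?_
  ring

end lattice

/-! ### §3e The gauge identity (step (ii) of the analytic heart), PROVED

For the temporal single-bond kernel of the witness,
`λ_j(ε₁,ε₂) = ∫_0^{2π} e^{-κ[a(1-cos v) + b sin v]} e^{-ijv} dv` (`a = 1 + iε₁`, `b = iε₂`), and any complex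
`R, ψ` with `R cos ψ = a`, `R sin ψ = b`:  `λ_j = e^{-κa} e^{ijψ} Λ_j(κR)`, `Λ_j(w) = ∫_0^{2π} e^{w cos u} e^{-iju} du`
(`= 2π I_j(w)`).  Consequence used in §3: on the charge-`Q` sector the transfer operator is `e^{iQψ}` times an
operator that no longer depends on `ψ`, so the Berry-like parameter `ε₂` only REWEIGHTS sectors (modulus tie),
while the complex stiffness enters through `κR`. The proof is a contour shift for an entire `2π`-periodic
integrand (Cauchy on a rectangle + periodicity). -/

section gauge

/-- shifting the integration segment of an entire `2π`-periodic function by a complex number. -/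
theorem intervalIntegral_comp_add_of_periodic_entire (h : ℂ → ℂ) (hd : Differentiable ℂ h)
    (hp : ∀ z : ℂ, h (z + 2 * Real.pi) = h z) (ψ : ℂ) :
    ∫ v in (0:ℝ)..2 * Real.pi, h ((v : ℂ) + ψ) = ∫ v in (0:ℝ)..2 * Real.pi, h v := by
  -- vertical shift by `ψ.im`: Cauchy's theorem on the rectangle [0, 2π] × [0, ψ.im]
  have hrect := Complex.integral_boundary_rect_eq_zero_of_differentiableOn h 0 (2 * Real.pi + ψ.im * Complex.I)
    hd.differentiableOn
  have hre : (2 * (Real.pi : ℂ) + (ψ.im : ℂ) * Complex.I).re = 2 * Real.pi := by simp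
  have him : (2 * (Real.pi : ℂ) + (ψ.im : ℂ) * Complex.I).im = ψ.im := by simp
  simp only [Complex.zero_re, Complex.zero_im, hre, him, Complex.ofReal_zero, zero_mul, add_zero,
    zero_add] at hrect
  -- the two vertical sides coincide by periodicity
  have hvert : (fun y : ℝ => h (((2 * Real.pi : ℝ) : ℂ) + y * Complex.I)) = fun y : ℝ => h (y * Complex.I) := by
    funext y
    have := hp (y * Complex.I)
    rw [← this]
    congr 1
    push_cast
    ring
  have hvert' : ∫ y : ℝ in (0:ℝ)..ψ.im, h (↑(2 * Real.pi) + ↑y * Complex.I) =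
      ∫ y : ℝ in (0:ℝ)..ψ.im, h (↑y * Complex.I) := by
    rw [show (fun y : ℝ => h (↑(2 * Real.pi) + ↑y * Complex.I)) =
      (fun y : ℝ => h (((2 * Real.pi : ℝ) : ℂ) + y * Complex.I)) from rfl, hvert]
  have hA : ∫ x : ℝ in (0:ℝ)..2 * Real.pi, h (↑x + ↑ψ.im * Complex.I) = ∫ x : ℝ in (0:ℝ)..2 * Real.pi, h ↑x := by
    have e1 := hrect
    rw [hvert'] at e1
    have e2 : (∫ x : ℝ in (0:ℝ)..2 * Real.pi, h ↑x) -
        (∫ x : ℝ in (0:ℝ)..2 * Real.pi, h (↑x + ↑ψ.im * Complex.I)) = 0 := by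
      simpa using e1
    exact (sub_eq_zero.1 e2).symm
  -- horizontal shift by `ψ.re`: periodicity of the real trace
  have hper : Function.Periodic (fun t : ℝ => h ((t : ℂ) + ψ.im * Complex.I)) (2 * Real.pi) := by
    intro t
    have := hp ((t : ℂ) + ψ.im * Complex.I)
    dsimp only
    rw [← this]
    congr 1
    push_cast
    ring
  have hB : ∫ v in (0:ℝ)..2 * Real.pi, h ((v : ℂ) + ψ) =
      ∫ t in ψ.re..ψ.re + 2 * Real.pi, h ((t : ℂ) + ψ.im * Complex.I) := by
    have hsub := intervalIntegral.integral_comp_add_right (a := (0:ℝ)) (b := 2 * Real.pi)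
      (fun t : ℝ => h ((t : ℂ) + ψ.im * Complex.I)) ψ.re
    simp only [zero_add] at hsub
    rw [show ψ.re + 2 * Real.pi = 2 * Real.pi + ψ.re by ring, ← hsub]
    refine intervalIntegral.integral_congr fun v _ => ?_
    show h ((v : ℂ) + ψ) = h (((v + ψ.re : ℝ) : ℂ) + ψ.im * Complex.I)
    congr 1
    conv_lhs => rw [← Complex.re_add_im ψ]
    push_cast
    ring
  rw [hB, hper.intervalIntegral_add_eq ψ.re 0, zero_add, hA]

/-- temporal single-bond kernel Fourier coefficient `λ_j = ∫_0^{2π} e^{-κ[a(1-cos v)+b sin v]} e^{-ijv} dv`. -/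
def tempCoeff (κ : ℝ) (a b : ℂ) (j : ℤ) : ℂ :=
  ∫ v in (0:ℝ)..2 * Real.pi,
    Complex.exp (-(κ : ℂ) * (a * (1 - Complex.cos v) + b * Complex.sin v)) * Complex.exp (-(Complex.I * j * v))

/-- pure cosine kernel coefficient `Λ_j(w) = ∫_0^{2π} e^{w cos u} e^{-iju} du` (`= 2π I_j(w)`). -/
def cosCoeff (w : ℂ) (j : ℤ) : ℂ :=
  ∫ u in (0:ℝ)..2 * Real.pi, Complex.exp (w * Complex.cos u) * Complex.exp (-(Complex.I * j * u))

/-- THE GAUGE IDENTITY `λ_j = e^{-κa} e^{ijψ} Λ_j(κR)` whenever `R cos ψ = a`, `R sin ψ = b`. -/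
theorem gauge_identity (κ : ℝ) (a b R ψ : ℂ) (hR : R * Complex.cos ψ = a) (hψ : R * Complex.sin ψ = b) (j : ℤ) :
    tempCoeff κ a b j = Complex.exp (-(κ : ℂ) * a) * Complex.exp (Complex.I * j * ψ) * cosCoeff ((κ : ℂ) * R) j := by
  set h : ℂ → ℂ := fun u => Complex.exp ((κ : ℂ) * R * Complex.cos u) * Complex.exp (-(Complex.I * j * u)) with hh
  have hd : Differentiable ℂ h := by
    rw [hh]; fun_prop
  have hp : ∀ z : ℂ, h (z + 2 * Real.pi) = h z := by
    intro z
    simp only [hh, Complex.cos_add_two_pi]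
    congr 1
    rw [show -(Complex.I * j * (z + 2 * Real.pi)) = -(Complex.I * j * z) + ((-j : ℤ) : ℂ) * (2 * Real.pi * Complex.I) by
      push_cast; ring, Complex.exp_add, Complex.exp_int_mul_two_pi_mul_I, mul_one]
  -- pointwise rewriting of the integrand
  have hpt : ∀ v : ℝ, Complex.exp (-(κ : ℂ) * (a * (1 - Complex.cos v) + b * Complex.sin v)) *
      Complex.exp (-(Complex.I * j * v)) =
      Complex.exp (-(κ : ℂ) * a) * Complex.exp (Complex.I * j * ψ) * h ((v : ℂ) + ψ) := by
    intro v
    simp only [hh, ← Complex.exp_add]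
    congr 1
    rw [Complex.cos_add, ← hR, ← hψ]
    ring
  unfold tempCoeff cosCoeff
  simp_rw [hpt]
  rw [intervalIntegral.integral_const_mul, intervalIntegral_comp_add_of_periodic_entire h hd hp ψ]

end gauge

/-! ## §4 The repair: time-reflection (Osterwalder–Schrader) Hermiticity of the table -/

/-- time reflection of the window `t ↦ r − 1 − t` acting on frequencies. -/
def timeReflect {r : ℕ} (n : Freq r) : Freq r := fun w => n (w.1, w.2.1, Fin.rev w.2.2)

/-- Osterwalder–Schrader (time-reflection) Hermiticity of a table: `c_{n∘R} = conj c_{−n}`, i.e.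
`F(φ ∘ R) = conj F(φ)` for real `φ`, `R` = time reflection of the window.  Every action obtained by integrating
out the fermions of a HAMILTONIAN model in imaginary time satisfies it (the weight of the time-reversed phase
path is the complex conjugate: `⟨Δ(τ+a)|e^{-aH}|Δ(τ)⟩^* = ⟨Δ(τ)|e^{-aH}|Δ(τ+a)⟩`).  It forces time-EVEN
terms (stiffnesses, in particular the temporal stiffness) to have REAL coefficients and allows imaginary parts
only on time-ODD terms (Berry phase `i n ∂_τθ` ↔ `iε₂ sin ∂_τθ`, `i(∂_τθ)(∇θ)²`, …).  Consequences:
`Z ∈ ℝ` (reflect the integration variable), and for `r = 2` the one-step transfer operator has a HERMITIAN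
inter-slice kernel, hence is similar to a self-adjoint operator: two dominant eigenvalues can no longer carry a
continuously tunable relative phase and the §3 mechanism is switched off (a zero of `Z` would need a NEGATIVE
eigenvalue tying the top one; j004976 part C: for the non-gauge time-odd terms `iε₃(sin 2v − 2 sin v)`,
`iε₃ sin v (1 − cos v)` with `ε₃ ≤ 3` the most negative transfer coefficient is `0.47/0.32/0.18` resp.
`0.31/0.18/0.06` of the top one at `κ = 8/32/128` — no tie, decreasing in κ; pure harmonics `sin 2v, sin 3v`
are gauge-dominated; with a wide enough `j`-window (j014044) ALL five odd terms `sin 2v, sin 3v, sin 2v − 2 sin v,`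
`sin v(1 − cos v), sin³v` at `ε₃ ≤ 3`, `κ = 8/32/128` have a POSITIVE maximal-modulus coefficient and worst
negative/positive ratio `0.51/0.38/0.24`, `0.66/0.58/0.48`, `0.47/0.32/0.18`, `0.31/0.18/0.06`, `0.47/0.32/0.18`
— below 1 and decreasing in κ: no tie, hence no zero of `Z_M = Σ_j λ_j^M` (`M ≥ 2`) and no blow-up of `⟨O⟩`
inside the repaired class at L = 1.  C′ survives its cheapest falsifier).
CAVEAT for the planner: for `r ≥ 3` the multi-slice transfer operator is only pseudo-Hermitian (spectrum closed
under conjugation), so a dominant complex-conjugate PAIR would make the REAL function `K ↦ Z` change sign —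
zeros of codimension one, no tuning of the table needed; genuine reflection POSITIVITY in time (as a Hamiltonian
origin provides) excludes that, bare Hermiticity does not obviously do so. -/
def TimeReflectionHermitian {r : ℕ} (c : Table r) : Prop :=
  ∀ n : Freq r, c (timeReflect n) = (starRingEnd ℂ) (c (-n))

theorem list_sum_apply {r : ℕ} (l : List (Table r)) (n : Freq r) :
    l.sum n = (l.map fun c => c n).sum := by
  induction l with
  | nil => simp
  | cons a l ih => simp [ih]

theorem dfreq_eq_zero_iff {u v : W 2} : dfreq u v = 0 ↔ u = v := by
  constructor
  · intro h
    by_contra huv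
    have := congrFun h u
    simp [dfreq, Ne.symm huv] at this
  · rintro rfl
    simp [dfreq]

/-- the zero-frequency coefficient of the witness: `8·1 + 4·(1 + iε₁)`. -/
theorem witness_apply_zero (ε₁ ε₂ : ℝ) : witness ε₁ ε₂ 0 = 12 + 4 * (Complex.I * ε₁) := by
  simp [witness, spatialTab, temporalCosTab, temporalSinTab, spatialEdges, temporalEdges,
    cosTab, sinTab, dfreq_eq_zero_iff]
  ring

/-- THE WITNESS IS NOT TIME-REFLECTION HERMITIAN as soon as `ε₁ ≠ 0` (its temporal stiffness
`1 + iε₁` is complex: already the zero-frequency coefficient `12 + 4iε₁` is not real), so the repaired class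
`AdmissibleOS` excludes it: the refutation mechanism of §3 does not bite C′.  (The Berry-like part
`iε₂ sin ∂_τθ` alone IS Hermitian — and harmless: pure gauge, see the gauge identity.) -/
theorem witness_not_timeReflectionHermitian {ε₁ : ℝ} (h : ε₁ ≠ 0) (ε₂ : ℝ) :
    ¬ TimeReflectionHermitian (witness ε₁ ε₂) := by
  intro hT
  have key := hT 0
  have h0 : timeReflect (0 : Freq 2) = 0 := rfl
  rw [h0, neg_zero, witness_apply_zero] at key
  have him := congrArg Complex.im key
  simp at him
  exact h (by linarith)

/-- … while it IS in the crux's class: the crux's class is strictly larger than the repaired one in a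
way that matters. -/
theorem witness_admissible_not_OS {ε₁ ε₂ : ℝ} (h₁ : |ε₁| ≤ 1) (h₂ : |ε₂| ≤ 1/5) (h : ε₁ ≠ 0) :
    Admissible 2 128 (1/18) (witness ε₁ ε₂) ∧ ¬ TimeReflectionHermitian (witness ε₁ ε₂) :=
  ⟨witness_admissible h₁ h₂, witness_not_timeReflectionHermitian h ε₂⟩

/-! ### §4a Under OS-Hermiticity the partition function is REAL (structural support for C′) -/

section osreal
variable {r : ℕ}

/-- time reflection of the window. -/
def Rw (w : W r) : W r := (w.1, w.2.1, Fin.rev w.2.2)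

@[simp] theorem Rw_Rw (w : W r) : Rw (Rw w) = w := by
  simp [Rw, Fin.rev_rev]

/-- `Rw` as an equivalence (an involution). -/
def RwEquiv : W r ≃ W r := ⟨Rw, Rw, Rw_Rw, Rw_Rw⟩

theorem timeReflect_apply (n : Freq r) (w : W r) : timeReflect n w = n (Rw w) := rfl

theorem timeReflect_neg (n : Freq r) : timeReflect (-n) = -timeReflect n := rfl

theorem timeReflect_timeReflect (n : Freq r) : timeReflect (timeReflect n) = n := by
  funext w; simp [timeReflect_apply]

/-- the support involution `n ↦ −(n∘R)`. -/
def invol (n : Freq r) : Freq r := -timeReflect n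

theorem invol_invol (n : Freq r) : invol (invol n) = n := by
  simp [invol, timeReflect_neg, timeReflect_timeReflect]

theorem apply_invol_of_OS {c : Table r} (hc : TimeReflectionHermitian c) (n : Freq r) :
    c (invol n) = (starRingEnd ℂ) (c n) := by
  have := hc (-n)
  simpa [invol, timeReflect_neg] using this

theorem dot_comp_Rw (n : Freq r) (φ : W r → ℝ) :
    (∑ w, (n w : ℝ) * φ (Rw w)) = ∑ w, ((timeReflect n) w : ℝ) * φ w := by
  rw [← Equiv.sum_comp (RwEquiv (r := r)) (fun w => ((timeReflect n) w : ℝ) * φ w)]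
  refine Finset.sum_congr rfl fun w _ => ?_
  simp [RwEquiv, timeReflect_apply]

/-- `F(φ ∘ R) = conj F(φ)` for an OS-Hermitian table. -/
theorem genF_comp_Rw_of_OS {c : Table r} (hc : TimeReflectionHermitian c) (φ : W r → ℝ) :
    genF c (fun w => φ (Rw w)) = (starRingEnd ℂ) (genF c φ) := by
  classical
  unfold genF Finsupp.sum
  rw [map_sum]
  -- reindex the left sum by the involution `invol`
  refine Finset.sum_nbij' invol invol (fun n hn => ?_) (fun n hn => ?_) (fun n _ => invol_invol n)
    (fun n _ => invol_invol n) (fun n _ => ?_)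
  · rw [Finsupp.mem_support_iff] at hn ⊢
    rw [apply_invol_of_OS hc]
    simpa using hn
  · rw [Finsupp.mem_support_iff] at hn ⊢
    rw [apply_invol_of_OS hc]
    simpa using hn
  · -- value: c n e^{i n·(φ∘R)} = conj (c (invol n) e^{i (invol n)·φ})
    dsimp only
    rw [map_mul, apply_invol_of_OS hc, Complex.conj_conj, ← Complex.exp_conj, dot_comp_Rw]
    congr 2
    simp only [invol, map_mul, map_neg, Complex.conj_I, Complex.conj_ofReal, Pi.neg_apply,
      Int.cast_neg, neg_mul, Finset.sum_neg_distrib, Complex.ofReal_neg]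
    ring

variable (r)

/-- time reversal `(x, τ) ↦ (x, −τ)` of the space-time torus. -/
def rho (L M : ℕ) : Λ L M ≃ Λ L M :=
  ⟨fun s => (s.1, -s.2), fun s => (s.1, -s.2), fun s => by simp, fun s => by simp⟩

/-- base-point reindexing `(x, τ) ↦ (x, −τ − (r−1))` matching window reflection. -/
def sig (L M : ℕ) : Λ L M ≃ Λ L M :=
  ⟨fun s => (s.1, -s.2 - ((r - 1 : ℕ) : ZMod M)), fun s => (s.1, -s.2 - ((r - 1 : ℕ) : ZMod M)),
    fun s => by ext <;> simp, fun s => by ext <;> simp⟩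

theorem sig_sig (L M : ℕ) (s : Λ L M) : sig r L M (sig r L M s) = s := (sig r L M).left_inv s

variable {r}

theorem rho_sh_sig (L M : ℕ) (hr : 1 ≤ r) (s : Λ L M) (w : W r) :
    rho L M (sh L M (sig r L M s) w) = sh L M s (Rw w) := by
  ext
  · simp [rho, sig, sh, Rw]
  · simp only [rho, sig, sh, Rw, Equiv.coe_fn_mk, Fin.val_rev]
    have hw : (w.2.2 : ℕ) + 1 ≤ r := w.2.2.isLt
    rw [Nat.cast_sub hw, Nat.cast_sub hr]
    push_cast
    ring

/-- `A(θ ∘ ρ) = conj A(θ)` for an OS-Hermitian table (and real `K`). -/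
theorem action_comp_rho_of_OS {c : Table r} (hc : TimeReflectionHermitian c) (hr : 1 ≤ r) (K : ℝ)
    (L M : ℕ) [NeZero L] [NeZero M] (θ : Λ L M → ℝ) :
    action K c L M (θ ∘ rho L M) = (starRingEnd ℂ) (action K c L M θ) := by
  unfold action
  rw [map_mul, Complex.conj_ofReal, map_sum]
  congr 1
  rw [← Equiv.sum_comp (sig r L M) (fun s => (starRingEnd ℂ) (genF c fun w => θ (sh L M s w)))]
  refine Finset.sum_congr rfl fun s _ => ?_
  rw [← genF_comp_Rw_of_OS hc]
  congr 1
  funext w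
  simp only [Function.comp_apply]
  have key := rho_sh_sig L M hr (sig r L M s) w
  rw [sig_sig] at key
  rw [key]

/-- the cube integral is invariant under reindexing the coordinates. -/
theorem integral_cube_comp_equiv (L M : ℕ) [NeZero L] [NeZero M] (e : Λ L M ≃ Λ L M)
    (g : (Λ L M → ℝ) → ℂ) :
    ∫ θ, g (θ ∘ e) ∂(volume.restrict (cube L M)) = ∫ θ, g θ ∂(volume.restrict (cube L M)) := by
  rw [restrict_cube_eq_pi]
  have h := (measurePreserving_piCongrLeft (fun _ : Λ L M => ν) e.symm).integral_comp'
    (f := MeasurableEquiv.piCongrLeft (fun _ : Λ L M => ℝ) e.symm) g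
  refine Eq.trans ?_ h
  congr 1
  funext θ
  congr 1
  funext i
  simp [MeasurableEquiv.piCongrLeft, Equiv.piCongrLeft_apply_eq_cast]

/-- Under OS-Hermiticity `Z` is REAL: `conj Z = Z`.  (So inside C′ a zero of `Z` can only come from a
SIGN CHANGE of a real quantity — impossible for the §3 table, whose `Z` is genuinely complex.) -/
theorem partZ_conj_of_OS {c : Table r} (hc : TimeReflectionHermitian c) (hr : 1 ≤ r) (K : ℝ)
    (L M : ℕ) [NeZero L] [NeZero M] :
    (starRingEnd ℂ) (partZ K c L M) = partZ K c L M := by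
  unfold partZ
  rw [← integral_conj]
  simp_rw [← Complex.exp_conj, map_neg, ← action_comp_rho_of_OS hc hr K L M]
  exact integral_cube_comp_equiv L M (rho L M) (fun θ => Complex.exp (-(action K c L M θ)))

end osreal

/-- the repaired admissible class. -/
def AdmissibleOS (r : ℕ) (B c₀ : ℝ) (c : Table r) : Prop :=
  Admissible r B c₀ c ∧ TimeReflectionHermitian c

/-- PROPOSED RESTATED CRUX C′ (weaker than the crux; the witness of §3 is excluded from its class). -/
def BirComplexStableXY_OS : Prop := EngineClaim AdmissibleOS

/-- C′ LITERALLY (planner copy-paste form, elaborates rc0): the crux's own text with the single extra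
hypothesis `(∀ n, c (fun w => n (w.1, w.2.1, Fin.rev w.2.2)) = (starRingEnd ℂ) (c (-n))) →` inserted after
coercivity (C).  `birComplexStableXY_OS_literal_iff` identifies it with `BirComplexStableXY_OS`. -/
def BirComplexStableXY_OS_literal : Prop :=
  ∀ (r : ℕ) (B c₀ : ℝ), 2 ≤ r → 0 < c₀ → ∃ K₀ : ℝ, ∃ L₀ : ℕ, ∀ K : ℝ, K₀ ≤ K → ∀ c : ((Fin r × Fin r × Fin r) → ℤ) →₀ ℂ, (∀ n ∈ c.support, ∑ w, n w = 0) → c.sum (fun _ a => a) = 0 → c.sum (fun n a => ‖a‖ * Real.exp (∑ w, |(n w : ℝ)|)) ≤ B → (∀ φ : (Fin r × Fin r × Fin r) → ℝ, c₀ * ∑ w, ∑ w', (1 - Real.cos (φ w - φ w')) ≤ ((fun (φ : (Fin r × Fin r × Fin r) → ℝ) => c.sum (fun n a => a * Complex.exp (Complex.I * ((∑ w, (n w : ℝ) * φ w : ℝ) : ℂ)))) φ).re) → (∀ n : (Fin r × Fin r × Fin r) → ℤ, c (fun w => n (w.1, w.2.1, Fin.rev w.2.2)) = (starRingEnd ℂ)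 (c (-n))) → ∀ (L M : ℕ) [NeZero L] [NeZero M], L₀ ≤ L → L ≤ M → let sh : (Literature.Probability.LatticeModels.TorusSite 2 L × ZMod M) → (Fin r × Fin r × Fin r) → (Literature.Probability.LatticeModels.TorusSite 2 L × ZMod M) := fun s w => (s.1 + ![((w.1 : ℕ) : ZMod L), ((w.2.1 : ℕ) : ZMod L)], s.2 + ((w.2.2 : ℕ) : ZMod M)); let F : ((Fin r × Fin r × Fin r) → ℝ) → ℂ := fun (φ : (Fin r × Fin r × Fin r) → ℝ) => c.sum (fun n a => a * Complex.exp (Complex.I * ((∑ w, (n w : ℝ) * φ w : ℝ) : ℂ))); let A : ((Literature.Probability.LatticeModels.TorusSite 2 L × ZMod M) → ℝ) → ℂ := fun θ => (K : ℂ) * ∑ s : (Literature.Probability.LatticeModels.TorusSite 2 L × ZMod M), F (fun w => θ (sh s w)); let cube : Set ((Literature.Probability.LatticeModels.TorusSite 2 L × ZMod M) → ℝ) := Set.pi Set.univ (fun _ => Set.Icc (0:ℝ) (2 * Real.pi)); let Z : ℂ := MeasureTheory.integral (MeasureTheory.volume.restrict cube) (fun θ => Complex.exp (-(A θ))); let O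 : ((Literature.Probability.LatticeModels.TorusSite 2 L × ZMod M) → ℝ) → ℝ := fun θ => ‖∑ x : Literature.Probability.LatticeModels.TorusSite 2 L, Complex.exp (Complex.I * (θ (x, 0) : ℂ))‖ ^ 2 / (L : ℝ) ^ 4; Z ≠ 0 ∧ (1/2 : ℝ) ≤ ((MeasureTheory.integral (MeasureTheory.volume.restrict cube) (fun θ => (O θ : ℂ) * Complex.exp (-(A θ)))) / Z).re

theorem birComplexStableXY_OS_literal_iff : BirComplexStableXY_OS_literal ↔ BirComplexStableXY_OS := by
  constructor
  · intro h r B c₀ hr hc₀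
    obtain ⟨K₀, L₀, hK⟩ := h r B c₀ hr hc₀
    refine ⟨K₀, L₀, fun K hKK c hc L M _ _ hL hLM => ?_⟩
    have key := hK K hKK c hc.1.1 hc.1.2.1 hc.1.2.2.1 hc.1.2.2.2 hc.2 L M hL hLM
    dsimp only at key
    dsimp only [Conclusion, partZ, numerO, action, genF, sh, cube, sliceO]
    exact key
  · intro h r B c₀ hr hc₀
    obtain ⟨K₀, L₀, hK⟩ := h r B c₀ hr hc₀
    refine ⟨K₀, L₀, fun K hKK c h1 h2 h3 h4 h5 L M _ _ hL hLM => ?_⟩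
    have key := hK K hKK c ⟨⟨h1, h2, h3, h4⟩, h5⟩ L M hL hLM
    dsimp only [Conclusion, partZ, numerO, action, genF, sh, cube, sliceO] at key
    dsimp only
    exact key

theorem os_of_crux : BirComplexStableXY → BirComplexStableXY_OS := by
  rw [← engineClaim_admissible_iff]
  intro h r B c₀ hr hc₀
  obtain ⟨K₀, L₀, hK⟩ := h r B c₀ hr hc₀
  exact ⟨K₀, L₀, fun K hKK c hc L M _ _ hL hLM => hK K hKK c hc.1 L M hL hLM⟩

end

end Summit.HubbardSuperconductivity.HubbardSuperconductivity.Cruxes.BirComplexStableXY.Disproof
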